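import Mathlib
import HarnessLib
import HarnessLib.Audit
import Summits.NavierStokesRegularity.Statement
import Summits.NavierStokesRegularity.NavierStokesRegularity.Theorems.NoBlowupToClay
import Literature.Analysis.FluidPDE.VectorCalculus
import Literature.Analysis.FluidPDE.ClassicalSolution
import Literature.Analysis.FluidPDE.LerayHopf
import Literature.Analysis.FluidPDE.SuitableWeak
import Literature.Analysis.FluidPDE.BlowupAncientSolution

/-!
Route: ExtremiserTransience

DORMANT since 2026-09-04T13:17:04Z (reconciler: no traction for 5 d (last activity item-proof-filed at 2026-08-30T12:24:23Z); parked, not closed — `ledger route dormant route-NavierStokesRegularity-ExtremiserTransience --off` to reactiv) — unstaffed, not closed; items shared with open routes are served there. `ledger route dormant <id> --off` reactivates.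

# Route ExtremiserTransience — Type-I exclusion beyond the constant-form depletion ceiling via
log-time transience of near-extremal vortex stretching

It suffices to show X = NearExtremalTransience ∧ DepletionCascade ∧ NoTypeII (a LINE of the
LADDER-NS hard core N0 / stmt-1217, director-ns 08-27T17:57Z «ceiling_lift = a NON-constant-form
input (structure of near-extremisers)»; no summit is proved by a line). The depletion ratio of a
divergence-free field v is R[v] = |∫⟪ω, Dv ω⟫| / (sup|v|·‖ω‖₂·‖∇ω‖₂), ω = curl v; its sharp constant
κ* is bracketed 23/500 < κ* ≤ (2+√3)/9 by tree theorems, and the CONSTANT-FORM ladder (a universal κ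
certifies the Type-I exclusion X_C iff κC < 1) is capped at C < 500/23 by theorem. The attacked
conjunct NearExtremalTransience replaces the constant by the LOG-TIME QUADRATIC MEAN of a flow-wise
depletion coefficient k(t) along a Type-I singular flow (weight dt/(T−t)): that mean is at most θκ
for a universal θ < 1 and every universal constant κ — near-extremisers of R (the
extreme-vortex-states objects) are dynamically transient. With the provable support AveragedRung
(mean-form rung: r·C < 1 ⇒ extension) this certifies X_C for C < 1/(θκ*), strictly beyond the reach
1/κ* of every constant-form rung. DepletionCascade (once log-mean depleted below the static ceiling,
depleted at every level) and NoTypeII (stmt-0056) are the declared RESIDUAL conjuncts, imported not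
attacked.
Lean: `NearExtremalTransience ∧ DepletionCascade ∧ NoTypeII`

## Assembly
Pure logic plus the landed frame
`Summit.NavierStokesRegularity.NavierStokesRegularity.Theorems.navierStokesRegularity_of_noBlowup`
(stmt-0055, consumed as a theorem): a non-extending classical Leray–Hopf rapidly-decaying-datum
solution is maximal, hence Type I at some level C = max(C'/√ν, 1) by NoTypeII;
NearExtremalTransience gives θ and, for every universal κ, log-mean depletion at level θκ;
DepletionCascade lowers the level to r = 1/(2C); AveragedRung (rC = 1/2 < 1) extends the solution
past T — contradiction; hence no blow-up, hence Clay (A). Certified in glue.lean (`closes (hT :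
NearExtremalTransience) (hC : DepletionCascade) (hII : NoTypeII) (hA : AveragedRung) :
NavierStokesRegularity`, Sketch.lean rc 0, no sorry) — every item is a consumed binder.

Rationale: WHY THIS LINE. Extremal-example mining on the depletion inequality: the instantaneous maximisers of
vortex-stretching / enstrophy production are known objects — Lu–Doering's colliding axisymmetric
vortex rings (LuDoering2008, Doering2009), the finite-time extreme vortex states of AyalaProtas2017
/ KangYunProtas2020, the variational extreme-event probes of FarazmandSapsis2017 — and every one of
them is TRANSIENT under the Navier–Stokes evolution (rings flatten into sheets, the maximal
instantaneous rate dZ/dt ~ Z³ is never sustained: realised growth ≈ Z^(3/2)); the tree's own static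
witnesses v_S, v_Q5 (Theorems/…StrainCubeCeiling(Sharper).lean) are Schwartz fields, not Type-I
slices. The line turns this into a typed flow-wise input: the log-time quadratic mean of the
stretching efficiency along a Type-I singular flow stays a factor θ < 1 below any universal
constant, and the enstrophy Grönwall against the rate √(T−t)‖u‖∞ ≤ C√ν (tree:
`lintegral_curl_sq_le_exp_of_flowwise_coeff`, `hasSmoothExtensionPast_of_powerRate`) converts a
mean-square coefficient r into the rung X_C for rC < 1 (AveragedRung). Imported:
extreme-vortex-states variational numerics (applied analysis) as the source of the extremal objects;
auxiliary-functional / time-average bounding (Fantuzzi–Goluskin, TobascoGoluskinDoering2018) as the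
proof technology for mean-form statements. What it does that prior routes do not: the strategist
line `depletion-ladder` (Cruxes/Target/Lines) and CollapseReynoldsRungTwo are CONSTANT-form (capped
at 500/23 by `constantForm_rung_ceiling_Q5`); ExtremalEnstrophy (draft) inducts on the
finite-horizon maximal enstrophy at fixed energy (subcritical budget, no Type-I rate);
ExtremalTypeIConstant minimises the Type-I constant over blow-ups; none uses a time-averaged
depletion coefficient, and nothing in the negatives index (5 entries) concerns depletion.

RANKED CRUXES. #2 NearExtremalTransience (crux) — There is a universal θ ∈ [0,1) such that for every
universal depletion constant κ (valid on the admissible class of `universal_depletion_constant_gt`: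
C^∞, divergence free, bounded with bounded gradient, D⁰v, D¹v, D²v ∈ L²) and every classical
Leray–Hopf rapidly-decaying-datum solution on [0,T) with eventual rate √(T−t)‖u(t,x)‖ ≤ C√ν that
does NOT extend past T, there are an onset t₁ < T, a measurable flow-wise depletion coefficient k :
ℝ → [0,1] (|∫⟪ω,Du ω⟫| ≤ k(t)·M·‖ω(t)‖₂‖∇ω(t)‖₂ for every bound M of |u(t)|, t ∈ [t₁,T)) and a
constant B with ∫_(t₁)^t k(τ)²dτ/(T−τ) ≤ (θκ)² log((T−t₁)/(T−t)) + B for all t ∈ [t₁,T):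
near-extremal stretching efficiency is transient in log-time quadratic mean (card K1). [difficulty:
XL] (why it might fail: A Type-I singularity could regenerate a near-extremal stretching
configuration at every scale (a DSS orbit through the near-extremal set), keeping the log-mean
efficiency at κ*; nothing known forbids R[U(s)] → κ* along a profile flow.) [LuDoering2008,
AyalaProtas2017, KangYunProtas2020, Doering2009, FarazmandSapsis2017, KNSS2009]
#3 DepletionCascade (crux) — RESIDUAL (imported, not attacked; the flow-wise analogue of
DescentToRungTwo stmt-20230): a classical Leray–Hopf rapidly-decaying-datum solution on [0,T) with
eventual rate C that does not extend past T and that is log-mean depleted strictly below the static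
ceiling (at level θκ for some θ < 1 and every universal κ, in the sense of crux 2) is log-mean
depleted at EVERY level r > 0. Implied by stmt-1217 (vacuously); with crux 2 and AveragedRung it
gives every rung X_C. [deps: NearExtremalTransience] [difficulty: open-problem] (why it might fail:
A Type-I singular flow may sit at an intermediate persistent efficiency r₀ ∈ (0, θκ*) forever (a
profile flow with 1/C ≤ R[U] < κ*), transient relative to the extremisers yet never fully depleted;
no level-lowering mechanism is known.) [KNSS2009, arXiv:0709.3599,
book:seregin2014-lecture-notes-regularity-theory-navier-stokes-equations, LuDoering2008]
#4 NoTypeII (crux) — RESIDUAL (shared item stmt-NavierStokesRegularity-0056, verbatim): a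
finite-energy classical solution from a rapidly decaying datum with maximal lifespan T < ∞ blows up
at the Type-I rate ‖u(t)‖∞ ≤ C(T−t)^(−1/2) eventually. [difficulty: open-problem] (why it might
fail: Type-II blow-up (diverging critical norms) is the expected generic failure mode of S; Tao's
averaged blow-up is Type II (arXiv:1402.0290 §1.1); nothing in this route addresses it.)
[arXiv:1402.0290, Tao2016AveragedNS,
book:seregin2014-lecture-notes-regularity-theory-navier-stokes-equations]
#9 AveragedRung (support) — MEAN-FORM RUNG (provable on the landed chain
`lintegral_curl_sq_le_exp_of_flowwise_coeff` + `hasSmoothExtensionPast_of_powerRate`, pattern of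
`rung_of_eventualDepletion`): if 0 ≤ r, 0 < C, rC < 1 and a classical Leray–Hopf
rapidly-decaying-datum solution on [0,T) with eventual rate C admits from some onset t₁ a measurable
flow-wise depletion coefficient k ∈ [0,1] whose weighted square integral ∫_(t₁)^t k²dτ/(T−τ) is at
most r² log((T−t₁)/(T−t)) + B, then it extends smoothly past T (enstrophy exponent r²C²/2 < 1/2
against Leray's H¹ rate). [difficulty: L] [Leray1934, LemarieRieusset2016,
RobinsonRodrigoSadowski2016]

TWO-LAYER PLAN. NearExtremalTransience ⇐ SaturationExit → ExitToLogMean → NearExtremalTransience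
(BC3 skeleton Lines/birth.lean): SaturationExit = on every log-time block [n, n+1) of s =
log((T−t₁)/(T−τ)) the saturated set {k > θ₀κ} has log-measure ≤ 1 − δ (universal θ₀ < 1, δ > 0) —
the dynamic stub, itself foreseen as (static) profile compactness of near-maximisers of R modulo
symmetries + (dynamic) non-invariance of the extremal set under the similarity-variable flow;
ExitToLogMean = the block bound gives log-mean level θ = √(1 − δ(1−θ₀²)) < 1 (bookkeeping, M).
Nothing filed now.

KILL CRITERIA. Refuted outright (close --reason refuted:NearExtremalTransience) by ONE Type-I
singular flow — or, short of that, one bounded ancient / DSS profile flow in Leray similarity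
variables — whose stretching efficiency R[U(s)] tends to the sharp constant κ* (persistent
saturation); a kit/DNS census showing R(t) pinned within 5% of the static supremum ≈ 0.14 throughout
the collapse phase of the standard candidates (colliding rings, antiparallel tubes,
Kerr/Hou–Luo-type data) forces a pivot to the block form with small δ. NoTypeII refuted (a Type-II
singularity) kills every ladder route including this one. Proved elsewhere: stmt-1217
(NoTypeIBlowup) moots cruxes 2–3.

NOT DECOMPOSED YET. The profile-compactness lemma for near-maximisers of R
(concentration-compactness modulo translations, rotations, dilations, amplitude), the identification
of the extremal configuration (axisymmetric strain diag(1,1,−2) with ω on the simple axis and flat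
speed — the equality case of `strainCube_pointwise_links_attained`), and the exit-time estimate of
the similarity-variable flow near it are layer-2 children of NearExtremalTransience; the value of κ*
is not needed (the crux quantifies over every universal κ).

CHEAPEST FALSIFIER. Kit job (≈ 2 core-h): take the lineage's numerical near-maximiser of R (kit
j021500/j021517, R ≈ 0.144, band-limited divergence-free field), evolve it under Navier–Stokes at
three Reynolds numbers for one eddy turnover and record R(t): the line predicts an immediate strict
drop (R has a strict local maximum in time at t = 0 with curvature bounded away from 0 in
scale-invariant units); a plateau of R at the extremal value over a turnover time kills the
transience mechanism at the first hurdle. Instrument row that would refute the key lemma: pub-fluidc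
DNS table «R(t) along collapse candidates» (colliding rings / antiparallel tubes), column log-mean
of R² over the last decade of (T*−t) versus the static sup.

NUMBERS. Sharp depletion constant κ*: 23/500 = 0.046 < κ* ≤ (2+√3)/9 = 0.4147 (tree:
`universal_depletion_constant_gt_Q5`, `sharp_constant_is_universal`); numerics κ* ≈ 0.14 (kit
j021500/j021517, depl3/depl4). Constant-form reach: landed C < 18 − 9√3 = 2.4115
(`rung_of_le_sharp`), cap C < 500/23 = 21.74 (`constantForm_rung_ceiling_Q5`). Mean-form reach of
this line: C < 1/(θκ*). Leray H¹ rate exponent 1/2 vs depleted exponent r²C²/2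
(`hasSmoothExtensionPast_of_powerRate`, γ < 1/2).

DEFINITION REQUESTS. None: the flow-wise coefficient, the log-time weight and the universal-constant
class are inlined over existing declarations (`Literature.Analysis.FluidPDE.curl`,
`frobeniusNormSq`, `VectorCalculus.IsDivFree`, `IsClassicalNSSolutionOn`, `IsLerayHopfOn`,
`HasRapidSpatialDecay`, `HasSmoothExtensionPast`, `intervalIntegral`).

Novelty: Searches (2026-08-27): lit search --hybrid "maximal enstrophy production vortex stretching sharp
bound Navier-Stokes extreme" (10 docs:
[corpus:book:doering1995-applied-analysis-navier-stokes-equations p.94] stretching term obstructs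
the 3-D enstrophy closure; [corpus:book:majda2002-vorticity-incompressible-flow p.166];
[corpus:book:foias2001-navier-stokes-equations-turbulence p.223]); lit vsearch "time-averaged vortex
stretching efficiency … maximisers transient" (10 docs, none on a time-averaged depletion
coefficient); lit galaxy search "maximum enstrophy|extreme vortex states|maximal enstrophy|enstrophy
production" --star all (26 rows: [galaxy:pdf:4770308468448022320] Farazmand–Sapsis arXiv:1704.04116
variational extreme-event probes; [galaxy:pdf:7672074237338834780] Fantuzzi–Goluskin bounding
extreme events by convex optimisation; panama: Frisch, Davidson, Doering–Gibbon); lean search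
`StretchingDepletion|flowwise|alignedPalinstrophyFraction` (tree: constant-form and eventual
flow-wise rungs, `frequently_alignedPalinstrophyFraction_lt`; no log-time-mean statement); ledger
negatives (5, none on depletion).
Nearest prior art found: LuDoering2008 / AyalaProtas2017 / KangYunProtas2020 (instantaneous and
finite-time maximal enstrophy growth: the extremal objects, no regularity mechanism); in tree the
strategist line `Cruxes/Target/Lines/depletion_ladder.lean` +
`Theorems/…FlowwiseDepletionEventualRung.lean` (constant / eventual-pointwise depletion, cap 500/23
by `constantForm_  [refs: 1704.04116, book:doering1995-applied-analysis-navier-stokes-equations, book:majda2002-vorticity-incompressible-flow, book:foias2001-navier-stokes-equations-turbulence, LuDoering2008, AyalaProtas2017, KangYunProtas2020]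

Barriers (technique_class: extremal-example mining, time-averaged depletion): - technique_class: extremal-example mining, time-averaged depletion
- Literature.Barriers.NavierStokesRegularity.EnergySupercriticality: evaded as by every rung of the
ladder — the enstrophy Grönwall is closed against the CRITICAL controlled quantity √(T−t)‖u‖∞ ≤ C√ν
supplied by the Type-I hypothesis (NoTypeII is the declared residual carrying the supercritical
half).
- Literature.Barriers.NavierStokesRegularity.AveragedTypeIBlowup: the tree's averaged equation HAS a
Type-I blow-up obeying the energy identity, so NearExtremalTransience must use structure of the true
nonlinearity beyond cancellation — it does: the depletion functional ∫⟪ω, Du ω⟫ = ∫det(u, ω, curl ω)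
with ω = curl u and the Betchov/strain-cube identities (`strainCube_pointwise_links_attained`) are
specific to B(u,u); the bet is that the extremal set of THIS functional is not invariant under the
true profile flow (for Tao's averaged nonlinearity the analogous production must saturate
persistently — the informative contrapositive).
- Literature.Barriers.NavierStokesRegularity.EnstrophyODENoGlobalClosure: outside its class — no
cubic law y' ≤ by³ is integrated; the coefficient is linear in Z with the log-integrable weight
k(t)²C²/(2(T−t)), exponent r²C²/2 < 1/2.
- Literature.Barriers.NavierStokesRegularity.VortexStretchingAprioriBounds: outside its class — no
conserved quantity is asked to bound sup|ω|; the stretching term is controlled by an explicitly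
posited, falsifiable dynamical statement (crux 2), not by an

History (route lifecycle, newest last):
- 2026-08-28T08:05:34Z · rev 11: informal re-worded for GalileanGainLeTwo (planner-ns-idea-5-g4-0)
- 2026-08-28T09:06:59Z · rev 12: informal re-worded for TangentExtremalExtraction (planner-ns-idea-5-g4-0)
- 2026-08-28T09:29:09Z · rev 13: informal re-worded for TangentExtremalExtraction (planner-ns-idea-5-g4-0)
- 2026-08-28T10:13:28Z · rev 14: informal re-worded for TangentExtremalExtraction (planner-ns-idea-5-g4-0)
- 2026-08-28T10:36:45Z · rev 15: informal re-worded for TangentExtremalExtraction (planner-ns-idea-5-g4-0)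
- 2026-08-28T10:41:01Z · rev 16: informal re-worded for TangentExtremalExtraction (planner-ns-idea-5-g4-0)
- 2026-08-28T12:21:47Z · rev 20: informal re-worded for SheetOrTangent (planner-ns-idea-5-g5-0)
- 2026-09-04T13:17:04Z · DORMANT — reconciler: no traction for 5 d (last activity item-proof-filed at 2026-08-30T12:24:23Z); parked, not closed — `ledger route dormant route-NavierStokesRegularit (operator:999:3329989)

sub-problem: NavierStokesRegularity · status: dormant · opened planner-ns-idea-5-g0-0 2026-08-27T20:28:17Z · rev 21 · ledger route-NavierStokesRegularity-ExtremiserTransience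
GENERATED by the gate from the ledger (D-0016/17). Provers cite these decls: `theorem foo : Summit.NavierStokesRegularity.NavierStokesRegularity.Theses.ExtremiserTransience.<Decl> := …` in Summits/NavierStokesRegularity/NavierStokesRegularity/Theorems/<Name>.lean.
-/

namespace Summit.NavierStokesRegularity.NavierStokesRegularity.Theses.ExtremiserTransience

open scoped BigOperators Topology Manifold Classical MeasureTheory ProbabilityTheory Matrix InnerProductSpace ComplexConjugate ContinuousMap
open Filter Set Function TopologicalSpace MeasureTheory

attribute [summit_statement] _root_.NavierStokesRegularity

open Literature.NS

/-! Retired items kept as plain definitions (history; not obligations of this route): landed proofs / closed glue still name them. -/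

/-- retired stmt-NavierStokesRegularity-28317 (moot, gen 1) — named by an active item. -/
def RegularisedNearPlateauStability : Prop :=
  ∀ A : ℕ → ℝ, (∀ j, 1 ≤ A j) → ∃ c₀ r : ℝ, 0 < c₀ ∧ 0 < r ∧ ∀ δ : ℝ, 0 < δ → ∃ ε : ℝ, 0 < ε ∧ ∀ (v : EuclideanSpace ℝ (Fin 3) → EuclideanSpace ℝ (Fin 3)) (M B : ℝ), ContDiff ℝ (⊤ : ℕ∞) v → Literature.Analysis.FluidPDE.VectorCalculus.IsDivFree v → (∀ x, ‖v x‖ ≤ M) → (∀ x, ‖fderiv ℝ v x‖ ≤ B) → (∫⁻ x, ‖iteratedFDeriv ℝ 0 v x‖ₑ ^ 2 < ⊤) → (∫⁻ x, ‖iteratedFDeriv ℝ 1 v x‖ₑ ^ 2 < ⊤) → (∫⁻ x, ‖iteratedFDeriv ℝ 2 v x‖ₑ ^ 2 < ⊤) → (∀ (j : ℕ) (x : EuclideanSpace ℝ (Fin 3)), ‖iteratedFDeriv ℝ j v x‖ ≤ A j * M * (Real.sqrt ((∫ x, ‖Literature.Analysis.FluidPDE.curl v x‖ ^ 2) / (∫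 x, Literature.Analysis.FluidPDE.frobeniusNormSq (fderiv ℝ (Literature.Analysis.FluidPDE.curl v) x))))⁻¹ ^ j) → 0 < M * Real.sqrt (∫ x, ‖Literature.Analysis.FluidPDE.curl v x‖ ^ 2) * Real.sqrt (∫ x, Literature.Analysis.FluidPDE.frobeniusNormSq (fderiv ℝ (Literature.Analysis.FluidPDE.curl v) x)) → (sInf {κ : ℝ | (∀ (v : EuclideanSpace ℝ (Fin 3) → EuclideanSpace ℝ (Fin 3)) (M B : ℝ), ContDiff ℝ (⊤ : ℕ∞) v → Literature.Analysis.FluidPDE.VectorCalculus.IsDivFree v → (∀ x, ‖v x‖ ≤ M) → (∀ x, ‖fderiv ℝ v x‖ ≤ B) → (∫⁻ x, ‖iteratedFDeriv ℝ 0 v x‖ₑ ^ 2 < ⊤) → (∫⁻ x, ‖iteratedFDeriv ℝ 1 v x‖ₑ ^ 2 < ⊤) → (∫⁻ x, ‖iteratedFDeriv ℝ 2 v x‖ₑ ^ 2 < ⊤) → |∫ x, ⟪Literature.Analysis.FluidPDE.curl v x, fderiv ℝ v x (Literature.Analysis.FluidPDE.curl v x)⟫_ℝ| ≤ κ * M *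 Real.sqrt (∫ x, ‖Literature.Analysis.FluidPDE.curl v x‖ ^ 2) * Real.sqrt (∫ x, Literature.Analysis.FluidPDE.frobeniusNormSq (fderiv ℝ (Literature.Analysis.FluidPDE.curl v) x)))} - ε) * M * Real.sqrt (∫ x, ‖Literature.Analysis.FluidPDE.curl v x‖ ^ 2) * Real.sqrt (∫ x, Literature.Analysis.FluidPDE.frobeniusNormSq (fderiv ℝ (Literature.Analysis.FluidPDE.curl v) x)) ≤ |∫ x, ⟪Literature.Analysis.FluidPDE.curl v x, fderiv ℝ v x (Literature.Analysis.FluidPDE.curl v x)⟫_ℝ| → ∃ x₀ : EuclideanSpace ℝ (Fin 3), ENNReal.ofReal (c₀ * (r * Real.sqrt ((∫ x, ‖Literature.Analysis.FluidPDE.curl v x‖ ^ 2) / (∫ x, Literature.Analysis.FluidPDE.frobeniusNormSq (fderiv ℝ (Literature.Analysis.FluidPDE.curl v) x)))) ^ 3) ≤ MeasureTheory.volume {x : EuclideanSpace ℝ (Fin 3) | x ∈ Metric.ball x₀ (r * Real.sqrt ((∫ x, ‖Literature.Analysis.FluidPDE.curl v x‖ ^ 2) / (∫ x, Literature.Analysis.FluidPDE.frobeniusNormSq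 (fderiv ℝ (Literature.Analysis.FluidPDE.curl v) x)))) ∧ (1 - δ) * M ≤ ‖v x‖}

/-- item stmt-NavierStokesRegularity-26567 · crux · rank 2 · closed · proved by Summit.NavierStokesRegularity.NavierStokesRegularity.Theorems.NearExtremalTransiencePerFlow_proof (prover) · by planner
why it might fail: ONE analytic Type-I singular flow may re-form asymptotically κ⋆-efficient slices at density-one log-times while its efficient (Z,P)-budget splits into R-neutral pieces (equal amplitude, equal Z/P) separating in parabolic units — then no tangent flow is extremal and θ_u = 1.
sources: LuDoering2008, KNSS2009, KangYunProtas2020, arXiv:2604.13338, AyalaProtas2017, Theorems/ExtremiserTransienceNearExtremalTransienceDSSPerFlowAnalytic.lean (dss_perFlow_logMean, slice_lt_sharp)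
retired/moot children: RegularisedNearPlateauStability [moot: ∀ A : ℕ → ℝ, (∀ j, 1 ≤ A j) → ∃ c₀ r : ℝ, 0 < c₀ ∧ 0 < r ∧ ∀ δ : ℝ, 0 < δ → ∃ ε ]
[crux] LINE g4-α «per-flow-tangent» (ns-idea-5 g4, extremal-example mining). PER-FLOW near-extremal
transience: every classical Leray–Hopf rapidly-decaying-datum flow on [0,T) with eventual rate
√(T−t)‖u‖ ≤ C√ν that does not extend past T has ITS OWN exponent θ_u ∈ [0,1) such that for every
universal depletion constant κ there are an onset t₁, a measurable flow-wise depletion coefficient k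
∈ [0,1] and B with ∫_(t₁)^t k²dτ/(T−τ) ≤ (θ_u κ)² log((T−t₁)/(T−t)) + B on [t₁,T). = VERBATIM the
hypothesis DepletionCascade consumes (its ∃θ sits after the flow), so the deciding theorem is
RE-GLUED to `closes (hT : NearExtremalTransiencePerFlow) (hC : DepletionCascade) (hII : NoTypeII)
(hA : AveragedRung)` (same proof, θ obtained per flow); the universal-θ crux NearExtremalTransience
(21883) implies this item by instantiation (`perFlow_of_uniform`, kernel-checked, HOME/lineL) and
stays the route's CEILING-LIFT statement (rung_of_nearExtremalTransience); 21883's lines close it a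
fortiori. WHY THIS LINE: birth.md records 21883 as atomic because (M3) uniformity of θ over all
Type-I singular flows cannot be bootstrapped — but `closes` never needed uniformity; the per-flow
statement is what single- -/
@[route_item "route-NavierStokesRegularity-ExtremiserTransience"]
def NearExtremalTransiencePerFlow : Prop :=
  ∀ (C ν T : ℝ), 0 < C → 0 < ν → 0 < T → ∀ (u : ℝ → EuclideanSpace ℝ (Fin 3) → EuclideanSpace ℝ (Fin 3)) (p : ℝ → EuclideanSpace ℝ (Fin 3) → ℝ), Literature.Analysis.FluidPDE.IsClassicalNSSolutionOn (Set.Ico 0 T) ν 0 u p → Literature.Analysis.FluidPDE.IsLerayHopfOn T ν 0 (u 0) u → Literature.Analysis.FluidPDE.HasRapidSpatialDecay (u 0) → (∀ᶠ t in 𝓝[<] T, ∀ x, Real.sqrt (T - t) * ‖u t x‖ ≤ C * Real.sqrt ν) → ¬ Literature.Analysis.FluidPDE.HasSmoothExtensionPast ν 0 u T → ∃ θ : ℝ, 0 ≤ θ ∧ θ < 1 ∧ ∀ κ : ℝ, (∀ (v : EuclideanSpace ℝ (Fin 3) → EuclideanSpace ℝ (Fin 3)) (M B : ℝ), ContDiff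 ℝ (⊤ : ℕ∞) v → Literature.Analysis.FluidPDE.VectorCalculus.IsDivFree v → (∀ x, ‖v x‖ ≤ M) → (∀ x, ‖fderiv ℝ v x‖ ≤ B) → (∫⁻ x, ‖iteratedFDeriv ℝ 0 v x‖ₑ ^ 2 < ⊤) → (∫⁻ x, ‖iteratedFDeriv ℝ 1 v x‖ₑ ^ 2 < ⊤) → (∫⁻ x, ‖iteratedFDeriv ℝ 2 v x‖ₑ ^ 2 < ⊤) → |∫ x, ⟪Literature.Analysis.FluidPDE.curl v x, fderiv ℝ v x (Literature.Analysis.FluidPDE.curl v x)⟫_ℝ| ≤ κ * M * Real.sqrt (∫ x, ‖Literature.Analysis.FluidPDE.curl v x‖ ^ 2) * Real.sqrt (∫ x, Literature.Analysis.FluidPDE.frobeniusNormSq (fderiv ℝ (Literature.Analysis.FluidPDE.curl v) x))) → ∃ t₁ ∈ Set.Ico 0 T, ∃ (k : ℝ → ℝ) (B : ℝ), Measurable k ∧ (∀ τ, 0 ≤ k τ ∧ k τ ≤ 1) ∧ (∀ t ∈ Set.Ico t₁ T, ∀ M : ℝ, (∀ x, ‖u t x‖ ≤ M) → |∫ x,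 ⟪Literature.Analysis.FluidPDE.curl (u t) x, fderiv ℝ (u t) x (Literature.Analysis.FluidPDE.curl (u t) x)⟫_ℝ| ≤ k t * M * Real.sqrt (∫ x, ‖Literature.Analysis.FluidPDE.curl (u t) x‖ ^ 2) * Real.sqrt (∫ x, Literature.Analysis.FluidPDE.frobeniusNormSq (fderiv ℝ (Literature.Analysis.FluidPDE.curl (u t)) x))) ∧ (∀ t ∈ Set.Ico t₁ T, ∫ τ in t₁..t, k τ ^ 2 / (T - τ) ≤ (θ * κ) ^ 2 * Real.log ((T - t₁) / (T - t)) + B)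

-- `NearExtremalTransiencePerFlow` holds: proved by `Summit.NavierStokesRegularity.NavierStokesRegularity.Theorems.NearExtremalTransiencePerFlow_proof` (its module imports this route file, so no `_holds` link can be stated here).

-- parent: NearExtremalTransiencePerFlow · child (gen 1)
/--     item stmt-NavierStokesRegularity-28318 · support · rank 202 · closed · proved by Summit.NavierStokesRegularity.NavierStokesRegularity.Theorems.ExtremiserTransience.RegularisedSliceTransfer_proof (prover)
    parent: NearExtremalTransiencePerFlow · by planner
    why it might fail: The higher Type-I rates (T1) for the classical pre-blow-up flow need a parabolic bootstrap typed only for mild windows so far; and the crux's M must be the Type-I envelope C√ν/√(T−t), which requires Leray's lower rate to keep (1−δ)M-levels non-empty — bookkeeping, but long.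
    sources: arXiv:0709.3599, Leray1934, Summits/NavierStokesRegularity/NavierStokesRegularity/Theorems/ExtremiserTransiencePerFlowScaleLock.lean, Summits/NavierStokesRegularity/NavierStokesRegularity/Theorems/ExtremiserTransienceZoomCompactness.lean
[support · LINE g6-α part 2/2 · dynamic transfer · M math / L–XL Lean] REGULARISED SLICE TRANSFER:
RegularisedNearPlateauStability ⇒ the weak one-slice object of `PlateauSliceTransfer` (27822),
verbatim conclusion, for every certificate-free Type-I singular Leray–Hopf flow. PLAN (= 27822
§S1-PLAN + one input): (T1) higher Type-I rates ‖Dʲu(t)‖_∞ ≤ C_j ν^{(1−j)/2}(T−t)^{−(j+1)/2}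
eventually (parabolic bootstrap: j=1 landed `PerFlow.gradTypeIRate_of_typeIRate`; all j on mild
windows `KNSSBootstrap.exists_norm_iteratedFDeriv_slice_le`,
`exists_norm_iteratedFDeriv_le_of_typeI_Ioo`); (T2) at the near-efficient TWO-SIDED-LOCKED times of
`PerFlow.scaleLock_at_nearEfficient_times` (c₁ν(T−t)P ≤ Z ≤ c₂ν(T−t)P; non-null for every ε, t₁) and
with `lerayLowerRate_of_not_extends`, the slice (u(t), M=C√ν/√(T−t)) is A-regular at scale λ with
A_j = C_j·c₂^{j/2}·C/c₀ — a PER-FLOW budget, so c₀(A), r(A) are fixed along the flow; (T3) apply the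
crux with δ_n ↓ 0, ε_n = ε(A,δ_n), t_n ↑ T; (T4) moving-centre zoom at the plateau ball with the
landed `volume_zoom_nearPlateau_ge`, `zoom_typeI_bound`, `zoomCompactnessKNSS` (S2),
`plateauPersistenceSlice` (S3) ⇒ weak-class object with an exact positive-volum -/
@[route_item "route-NavierStokesRegularity-ExtremiserTransience"]
def RegularisedSliceTransfer : Prop :=
  RegularisedNearPlateauStability → ∀ (C ν T : ℝ), 0 < C → 0 < ν → 0 < T → ∀ (u : ℝ → EuclideanSpace ℝ (Fin 3) → EuclideanSpace ℝ (Fin 3)) (p : ℝ → EuclideanSpace ℝ (Fin 3) → ℝ), Literature.Analysis.FluidPDE.IsClassicalNSSolutionOn (Set.Ico 0 T) ν 0 u p → Literature.Analysis.FluidPDE.IsLerayHopfOn T ν 0 (u 0) u → Literature.Analysis.FluidPDE.HasRapidSpatialDecay (u 0) → (∀ᶠ t in 𝓝[<] T, ∀ x, Real.sqrt (T - t) * ‖u t x‖ ≤ C * Real.sqrt ν) → ¬ Literature.Analysis.FluidPDE.HasSmoothExtensionPast ν 0 u T → ¬ (∃ θ : ℝ, 0 ≤ θ ∧ θ < 1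 ∧ ∀ κ : ℝ, (∀ (v : EuclideanSpace ℝ (Fin 3) → EuclideanSpace ℝ (Fin 3)) (M B : ℝ), ContDiff ℝ (⊤ : ℕ∞) v → Literature.Analysis.FluidPDE.VectorCalculus.IsDivFree v → (∀ x, ‖v x‖ ≤ M) → (∀ x, ‖fderiv ℝ v x‖ ≤ B) → (∫⁻ x, ‖iteratedFDeriv ℝ 0 v x‖ₑ ^ 2 < ⊤) → (∫⁻ x, ‖iteratedFDeriv ℝ 1 v x‖ₑ ^ 2 < ⊤) → (∫⁻ x, ‖iteratedFDeriv ℝ 2 v x‖ₑ ^ 2 < ⊤) → |∫ x, ⟪Literature.Analysis.FluidPDE.curl v x, fderiv ℝ v x (Literature.Analysis.FluidPDE.curl v x)⟫_ℝ| ≤ κ * M * Real.sqrt (∫ x, ‖Literature.Analysis.FluidPDE.curl v x‖ ^ 2) * Real.sqrt (∫ x, Literature.Analysis.FluidPDE.frobeniusNormSq (fderiv ℝ (Literature.Analysis.FluidPDE.curl v) x))) → ∃ t₁ ∈ Set.Ico 0 T, ∃ (k : ℝ → ℝ) (B : ℝ), Measurable k ∧ (∀ τ, 0 ≤ k τ ∧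 k τ ≤ 1) ∧ (∀ t ∈ Set.Ico t₁ T, ∀ M : ℝ, (∀ x, ‖u t x‖ ≤ M) → |∫ x, ⟪Literature.Analysis.FluidPDE.curl (u t) x, fderiv ℝ (u t) x (Literature.Analysis.FluidPDE.curl (u t) x)⟫_ℝ| ≤ k t * M * Real.sqrt (∫ x, ‖Literature.Analysis.FluidPDE.curl (u t) x‖ ^ 2) * Real.sqrt (∫ x, Literature.Analysis.FluidPDE.frobeniusNormSq (fderiv ℝ (Literature.Analysis.FluidPDE.curl (u t)) x))) ∧ (∀ t ∈ Set.Ico t₁ T, ∫ τ in t₁..t, k τ ^ 2 / (T - τ) ≤ (θ * κ) ^ 2 * Real.log ((T - t₁) / (T - t)) + B)) → ∃ (W : ℝ → EuclideanSpace ℝ (Fin 3) → EuclideanSpace ℝ (Fin 3)) (K t₀ m : ℝ), ContinuousOn (Function.uncurry W) (Set.Iio (0 : ℝ) ×ˢ Set.univ) ∧ (∀ s t : ℝ, s < t → t < 0 → ∀ x, W t x = Literature.Analysis.FluidPDE.heatFlow (W s) (t - s) x - Literature.Analysis.FluidPDE.oseenDuhamel 1 s W W t x) ∧ (∀ t : ℝ,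 t < 0 → ∀ x, Real.sqrt (-t) * ‖W t x‖ ≤ K) ∧ t₀ < 0 ∧ 0 < m ∧ (∀ y, ‖W t₀ y‖ ≤ m) ∧ 0 < MeasureTheory.volume {y : EuclideanSpace ℝ (Fin 3) | ‖W t₀ y‖ = m}

-- `RegularisedSliceTransfer` holds: proved by `Summit.NavierStokesRegularity.NavierStokesRegularity.Theorems.ExtremiserTransience.RegularisedSliceTransfer_proof` (its module imports this route file, so no `_holds` link can be stated here).

-- parent: NearExtremalTransiencePerFlow · glue (gen 1)
/--     item stmt-NavierStokesRegularity-28319 · support · rank 203 · closed · proved by Summit.NavierStokesRegularity.NavierStokesRegularity.Theses.ExtremiserTransience.netpfOfRegularised (planner)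
    parent: NearExtremalTransiencePerFlow · GLUE: children ⟹ parent · by planner
GLUE (logic + landed rigidity): RegularisedNearPlateauStability → RegularisedSliceTransfer →
NearExtremalTransiencePerFlow; term: fun h1 h2 C ν T hC hν hT u p hcl hLH hdec hrate hne =>
by_contra fun hno => plateauSliceRigidity (h2 h1 C ν T hC hν hT u p hcl hLH hdec hrate hne hno) —
kernel-checked in the planner sketch lineS/Sketch.lean (`netpfOfRegularised`, rc 0, 0 sorries; also
`regularised_of_lnps : LocalNearPlateauStability → RegularisedNearPlateauStability`), to be landed
--supports this glue item at once. LINE g6-α «regularised bang-bang» (ns-idea-5 g6, extremal-example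
mining): a second, REGULARISED path to 26567 beside 27676 → 27822 → 27823; no summit is proved by a
line. -/
@[route_item "route-NavierStokesRegularity-ExtremiserTransience"]
def NETPFOfRegularised : Prop :=
  RegularisedNearPlateauStability → RegularisedSliceTransfer → NearExtremalTransiencePerFlow

-- `NETPFOfRegularised` holds: proved by `Summit.NavierStokesRegularity.NavierStokesRegularity.Theses.ExtremiserTransience.netpfOfRegularised` (its module imports this route file, so no `_holds` link can be stated here).

/-- item stmt-NavierStokesRegularity-21884 · crux · rank 3 · open · by planner
why it might fail: A Type-I singular flow may sit at an intermediate persistent efficiency r₀ ∈ (0, θκ*) forever (a profile flow with 1/C ≤ R[U] < κ*), transient relative to the extremisers yet never fully depleted; no level-lowering mechanism is known.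
sources: KNSS2009, arXiv:0709.3599, book:seregin2014-lecture-notes-regularity-theory-navier-stokes-equations, LuDoering2008
[crux] RESIDUAL (imported, not attacked; the flow-wise analogue of DescentToRungTwo stmt-20230): a
classical Leray–Hopf rapidly-decaying-datum solution on [0,T) with eventual rate C that does not
extend past T and that is log-mean depleted strictly below the static ceiling (at level θκ for some
θ < 1 and every universal κ, in the sense of crux 2) is log-mean depleted at EVERY level r > 0.
Implied by stmt-1217 (vacuously); with crux 2 and AveragedRung it gives every rung X_C. [deps:
NearExtremalTransience] [difficulty: open-problem] -/
@[route_item "route-NavierStokesRegularity-ExtremiserTransience"]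
def DepletionCascade : Prop :=
  ∀ (C ν T : ℝ), 0 < C → 0 < ν → 0 < T → ∀ (u : ℝ → EuclideanSpace ℝ (Fin 3) → EuclideanSpace ℝ (Fin 3)) (p : ℝ → EuclideanSpace ℝ (Fin 3) → ℝ), Literature.Analysis.FluidPDE.IsClassicalNSSolutionOn (Set.Ico 0 T) ν 0 u p → Literature.Analysis.FluidPDE.IsLerayHopfOn T ν 0 (u 0) u → Literature.Analysis.FluidPDE.HasRapidSpatialDecay (u 0) → (∀ᶠ t in 𝓝[<] T, ∀ x, Real.sqrt (T - t) * ‖u t x‖ ≤ C * Real.sqrt ν) → ¬ Literature.Analysis.FluidPDE.HasSmoothExtensionPast ν 0 u T → (∃ θ : ℝ, 0 ≤ θ ∧ θ < 1 ∧ ∀ κ : ℝ, (∀ (v : EuclideanSpace ℝ (Fin 3) → EuclideanSpace ℝ (Fin 3)) (M B : ℝ), ContDiff ℝ (⊤ : ℕ∞) v → Literature.Analysis.FluidPDE.VectorCalculus.IsDivFree v → (∀ x, ‖v x‖ ≤ M) → (∀ x, ‖fderiv ℝ v x‖ ≤ B) → (∫⁻ x, ‖iteratedFDeriv ℝ 0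 v x‖ₑ ^ 2 < ⊤) → (∫⁻ x, ‖iteratedFDeriv ℝ 1 v x‖ₑ ^ 2 < ⊤) → (∫⁻ x, ‖iteratedFDeriv ℝ 2 v x‖ₑ ^ 2 < ⊤) → |∫ x, ⟪Literature.Analysis.FluidPDE.curl v x, fderiv ℝ v x (Literature.Analysis.FluidPDE.curl v x)⟫_ℝ| ≤ κ * M * Real.sqrt (∫ x, ‖Literature.Analysis.FluidPDE.curl v x‖ ^ 2) * Real.sqrt (∫ x, Literature.Analysis.FluidPDE.frobeniusNormSq (fderiv ℝ (Literature.Analysis.FluidPDE.curl v) x))) → ∃ t₁ ∈ Set.Ico 0 T, ∃ (k : ℝ → ℝ) (B : ℝ), Measurable k ∧ (∀ τ, 0 ≤ k τ ∧ k τ ≤ 1) ∧ (∀ t ∈ Set.Ico t₁ T, ∀ M : ℝ, (∀ x, ‖u t x‖ ≤ M) → |∫ x, ⟪Literature.Analysis.FluidPDE.curl (u t) x, fderiv ℝ (u t) x (Literature.Analysis.FluidPDE.curl (u t) x)⟫_ℝ| ≤ k t * M * Real.sqrt (∫ x, ‖Literature.Analysis.FluidPDE.curl (u t) x‖ ^ 2)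 * Real.sqrt (∫ x, Literature.Analysis.FluidPDE.frobeniusNormSq (fderiv ℝ (Literature.Analysis.FluidPDE.curl (u t)) x))) ∧ (∀ t ∈ Set.Ico t₁ T, ∫ τ in t₁..t, k τ ^ 2 / (T - τ) ≤ (θ * κ) ^ 2 * Real.log ((T - t₁) / (T - t)) + B)) → ∀ r : ℝ, 0 < r → ∃ t₁ ∈ Set.Ico 0 T, ∃ (k : ℝ → ℝ) (B : ℝ), Measurable k ∧ (∀ τ, 0 ≤ k τ ∧ k τ ≤ 1) ∧ (∀ t ∈ Set.Ico t₁ T, ∀ M : ℝ, (∀ x, ‖u t x‖ ≤ M) → |∫ x, ⟪Literature.Analysis.FluidPDE.curl (u t) x, fderiv ℝ (u t) x (Literature.Analysis.FluidPDE.curl (u t) x)⟫_ℝ| ≤ k t * M * Real.sqrt (∫ x, ‖Literature.Analysis.FluidPDE.curl (u t) x‖ ^ 2) * Real.sqrt (∫ x, Literature.Analysis.FluidPDE.frobeniusNormSq (fderiv ℝ (Literature.Analysis.FluidPDE.curl (u t)) x))) ∧ (∀ t ∈ Set.Ico t₁ T, ∫ τ in t₁..t, k τ ^ 2 / (T - τ)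 ≤ (r) ^ 2 * Real.log ((T - t₁) / (T - t)) + B)

/-- item stmt-NavierStokesRegularity-0056 · crux · rank 4 · open · by planner
why it might fail: Type-II blow-up (diverging critical norms) is the expected generic failure mode of S; Tao's averaged blow-up is Type II (arXiv:1402.0290 §1.1); nothing in this route addresses it.
sources: arXiv:1402.0290, Tao2016AveragedNS, book:seregin2014-lecture-notes-regularity-theory-navier-stokes-equations
If a finite-energy classical solution from a rapidly decaying datum has maximal lifespan T<∞ (no
classical extension past T), then ‖u(t)‖_∞ ≤ C (T−t)^{-1/2} eventually as t↑T (Leray's rate is the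
matching lower bound, leray_blowup_rate_top). The hardest and most informative crux: a
counterexample is a Type II singularity, i.e. ¬(Clay A). Known: lower bound c√ν (T−t)^{-1/2} (Leray
1934 §20); L³ must blow up (ESS 2003, Seregin 2012); only triple-log quantitative gain (Tao 2021). -/
@[route_item "route-NavierStokesRegularity-ExtremiserTransience"]
def NoTypeII : Prop :=
  ∀ (ν T : ℝ), 0 < ν → 0 < T → ∀ (u : ℝ → EuclideanSpace ℝ (Fin 3) → EuclideanSpace ℝ (Fin 3)) (p : ℝ → EuclideanSpace ℝ (Fin 3) → ℝ), Literature.Analysis.FluidPDE.IsMaximalSmoothSolution ν 0 u p T → Literature.Analysis.FluidPDE.IsLerayHopfOn T ν 0 (u 0) u → Literature.Analysis.FluidPDE.HasRapidSpatialDecay (u 0) → Literature.Analysis.FluidPDE.IsTypeIBlowup u T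

/-- item stmt-NavierStokesRegularity-21883 · aside · rank 2 · open · by planner
why it might fail: A Type-I singularity could regenerate a near-extremal stretching configuration at every scale (a DSS orbit through the near-extremal set), keeping the log-mean efficiency at κ*; nothing known forbids R[U(s)] → κ* along a profile flow.
sources: LuDoering2008, AyalaProtas2017, KangYunProtas2020, Doering2009, FarazmandSapsis2017, KNSS2009
[crux] There is a universal θ ∈ [0,1) such that for every universal depletion constant κ (valid on
the admissible class of `universal_depletion_constant_gt`: C^∞, divergence free, bounded with
bounded gradient, D⁰v, D¹v, D²v ∈ L²) and every classical Leray–Hopf rapidly-decaying-datum solution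
on [0,T) with eventual rate √(T−t)‖u(t,x)‖ ≤ C√ν that does NOT extend past T, there are an onset t₁
< T, a measurable flow-wise depletion coefficient k : ℝ → [0,1] (|∫⟪ω,Du ω⟫| ≤
k(t)·M·‖ω(t)‖₂‖∇ω(t)‖₂ for every bound M of |u(t)|, t ∈ [t₁,T)) and a constant B with ∫_(t₁)^t
k(τ)²dτ/(T−τ) ≤ (θκ)² log((T−t₁)/(T−t)) + B for all t ∈ [t₁,T): near-extremal stretching efficiency
is transient in log-time quadratic mean (card K1). [difficulty: XL] -/
@[route_item "route-NavierStokesRegularity-ExtremiserTransience"]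
def NearExtremalTransience : Prop :=
  ∃ θ : ℝ, 0 ≤ θ ∧ θ < 1 ∧ ∀ κ : ℝ, (∀ (v : EuclideanSpace ℝ (Fin 3) → EuclideanSpace ℝ (Fin 3)) (M B : ℝ), ContDiff ℝ (⊤ : ℕ∞) v → Literature.Analysis.FluidPDE.VectorCalculus.IsDivFree v → (∀ x, ‖v x‖ ≤ M) → (∀ x, ‖fderiv ℝ v x‖ ≤ B) → (∫⁻ x, ‖iteratedFDeriv ℝ 0 v x‖ₑ ^ 2 < ⊤) → (∫⁻ x, ‖iteratedFDeriv ℝ 1 v x‖ₑ ^ 2 < ⊤) → (∫⁻ x, ‖iteratedFDeriv ℝ 2 v x‖ₑ ^ 2 < ⊤) → |∫ x, ⟪Literature.Analysis.FluidPDE.curl v x, fderiv ℝ v x (Literature.Analysis.FluidPDE.curl v x)⟫_ℝ| ≤ κ * M * Real.sqrt (∫ x, ‖Literature.Analysis.FluidPDE.curl v x‖ ^ 2) * Real.sqrt (∫ x, Literature.Analysis.FluidPDE.frobeniusNormSq (fderiv ℝ (Literature.Analysis.FluidPDE.curl v) x))) → ∀ (C ν T : ℝ), 0 < C → 0 < ν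 → 0 < T → ∀ (u : ℝ → EuclideanSpace ℝ (Fin 3) → EuclideanSpace ℝ (Fin 3)) (p : ℝ → EuclideanSpace ℝ (Fin 3) → ℝ), Literature.Analysis.FluidPDE.IsClassicalNSSolutionOn (Set.Ico 0 T) ν 0 u p → Literature.Analysis.FluidPDE.IsLerayHopfOn T ν 0 (u 0) u → Literature.Analysis.FluidPDE.HasRapidSpatialDecay (u 0) → (∀ᶠ t in 𝓝[<] T, ∀ x, Real.sqrt (T - t) * ‖u t x‖ ≤ C * Real.sqrt ν) → ¬ Literature.Analysis.FluidPDE.HasSmoothExtensionPast ν 0 u T → ∃ t₁ ∈ Set.Ico 0 T, ∃ (k : ℝ → ℝ) (B : ℝ), Measurable k ∧ (∀ τ, 0 ≤ k τ ∧ k τ ≤ 1) ∧ (∀ t ∈ Set.Ico t₁ T, ∀ M : ℝ, (∀ x, ‖u t x‖ ≤ M) → |∫ x, ⟪Literature.Analysis.FluidPDE.curl (u t) x, fderiv ℝ (u t) x (Literature.Analysis.FluidPDE.curl (u t) x)⟫_ℝ| ≤ k t * M * Real.sqrt (∫ x, ‖Literature.Analysis.FluidPDE.curl (u t) x‖ ^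 2) * Real.sqrt (∫ x, Literature.Analysis.FluidPDE.frobeniusNormSq (fderiv ℝ (Literature.Analysis.FluidPDE.curl (u t)) x))) ∧ (∀ t ∈ Set.Ico t₁ T, ∫ τ in t₁..t, k τ ^ 2 / (T - τ) ≤ (θ * κ) ^ 2 * Real.log ((T - t₁) / (T - t)) + B)

/-- item stmt-NavierStokesRegularity-26686 · banked · rank 5 · closed · proved by Summit.NavierStokesRegularity.NavierStokesRegularity.Theorems.homogeneousSharpConstant_proof (prover) · by planner
why it might fail: Galilean gain is real at class level (+13 % single-width deg 5, +1–1.5 % two-width classes, kit j302461); a one-sided velocity range at the true extremiser (jet through unequal coaxial rings) would make κ⋆^hom > κ⋆ and the item false.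
sources: LuDoering2008, KangYunProtas2020, AyalaProtas2017, KNSS2009, kit:j302461, Theorems/ExtremiserTransienceNearExtremalTransienceSharpConstant.lean (sharpDepletion_is_universal, sharp bracket)
[crux] LINE g4-β «galilean-gauge» (ns-idea-5 g4, extremal-example mining: the extremisers' symmetry
orbit). HOMOGENEOUS SHARP CONSTANT: the L²-class sharp constant κ⋆ = sInf V (a genuine infimum, not
junk: `DepletionLadder.universal_depletion_constant_nonneg` BddBelow, `sharpDepletion_le_lambSplit`
member, `sharpDepletion_gt` 13/200 < κ⋆ — provers cite, do not re-prove) is universal on the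
HOMOGENEOUS class (C^∞, div-free, |v| ≤ M, bounded gradient, D¹v, D²v ∈ L², NO v ∈ L² clause). WHY
THIS LINE: the L² clause secretly fixes the Galilean frame; KNSS tangent flows do not decay, so the
extremal object of both tangent lines — EXT in NoExtremalAncient (26569) = K1/K1b of
Lines/extremiser_liouville — lives in the homogeneous class, on which boosts v ↦ c + v ACT: J, Z, P
are invariant, sup|c+v| is not. Every homogeneous field is c + w with w → 0 (Ḣ¹ ⊂ L⁶ mod constants),
so κ⋆^hom = sup_(w,c) J(w)/(‖c+w‖_∞ √Z √P) ∈ [κ⋆, 2κ⋆] (‖c+w‖_∞ ≥ Chebyshev radius of the velocity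
range ≥ ‖w‖_∞/2), and THIS ITEM ⟺ κ⋆^hom = κ⋆ ⟺ no Galilean gain at the top. DICHOTOMY it decides:
TRUE ⇒ K1b is an honest top-of-class rigidity statement (with the new feature that contact may sit
AT INFINITY, |c| = M, out -/
@[route_item "route-NavierStokesRegularity-ExtremiserTransience"]
def HomogeneousSharpConstant : Prop :=
  ∀ (v : EuclideanSpace ℝ (Fin 3) → EuclideanSpace ℝ (Fin 3)) (M B : ℝ), ContDiff ℝ (⊤ : ℕ∞) v → Literature.Analysis.FluidPDE.VectorCalculus.IsDivFree v → (∀ x, ‖v x‖ ≤ M) → (∀ x, ‖fderiv ℝ v x‖ ≤ B) → (∫⁻ x, ‖iteratedFDeriv ℝ 1 v x‖ₑ ^ 2 < ⊤) → (∫⁻ x, ‖iteratedFDeriv ℝ 2 v x‖ₑ ^ 2 < ⊤) → |∫ x, ⟪Literature.Analysis.FluidPDE.curl v x, fderiv ℝ v x (Literature.Analysis.FluidPDE.curl v x)⟫_ℝ| ≤ sInf {κ : ℝ | (∀ (v : EuclideanSpace ℝ (Fin 3) → EuclideanSpace ℝ (Fin 3)) (M B : ℝ), ContDiff ℝ (⊤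 : ℕ∞) v → Literature.Analysis.FluidPDE.VectorCalculus.IsDivFree v → (∀ x, ‖v x‖ ≤ M) → (∀ x, ‖fderiv ℝ v x‖ ≤ B) → (∫⁻ x, ‖iteratedFDeriv ℝ 0 v x‖ₑ ^ 2 < ⊤) → (∫⁻ x, ‖iteratedFDeriv ℝ 1 v x‖ₑ ^ 2 < ⊤) → (∫⁻ x, ‖iteratedFDeriv ℝ 2 v x‖ₑ ^ 2 < ⊤) → |∫ x, ⟪Literature.Analysis.FluidPDE.curl v x, fderiv ℝ v x (Literature.Analysis.FluidPDE.curl v x)⟫_ℝ| ≤ κ * M * Real.sqrt (∫ x, ‖Literature.Analysis.FluidPDE.curl v x‖ ^ 2) * Real.sqrt (∫ x, Literature.Analysis.FluidPDE.frobeniusNormSq (fderiv ℝ (Literature.Analysis.FluidPDE.curl v) x)))} * M * Real.sqrt (∫ x, ‖Literature.Analysis.FluidPDE.curl v x‖ ^ 2) * Real.sqrt (∫ x, Literature.Analysis.FluidPDE.frobeniusNormSq (fderiv ℝ (Literature.Analysis.FluidPDE.curl v) x))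

-- `HomogeneousSharpConstant` holds: proved by `Summit.NavierStokesRegularity.NavierStokesRegularity.Theorems.homogeneousSharpConstant_proof` (its module imports this route file, so no `_holds` link can be stated here).

/-- item stmt-NavierStokesRegularity-27676 · aside · rank 6 · open · by planner
why it might fail: κ⋆ may not be attained (KStarAttained 24370 open: vanishing/dichotomy of maximising sequences, Lions 1984), and near-maximisers may have generic quadratic speed maxima, so the near-top fraction decays like δ^{3/2}: no δ-uniform c₀ (numerical maximisers of Lu–Doering type look smooth-peaked).
sources: Lions1984, LuDoering2008, KangYunProtas2020, AyalaProtas2017, Summits/NavierStokesRegularity/NavierStokesRegularity/Theorems/ExtremiserTransienceKStarAttainedContact.lean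
[crux · LINE g5-α «plateau transfer» (ns-idea-5 g5, technique: extremal-example mining) part 1/3 ·
static variational · size XL] LOCAL NEAR-PLATEAU STABILITY of the sharp depletion inequality |J(v)|
≤ κ⋆·M·√Z·√P on the L² admissible class (κ⋆ = the sInf constant of NearExtremalTransience; J =
∫⟨ω,∇v ω⟩, Z = ∫|ω|², P = ∫|∇ω|²): there are c₀, r > 0 such that for every δ > 0 some ε > 0 makes
every non-degenerate admissible (v, M, B) with |J| ≥ (κ⋆ − ε)·M·√Z·√P contain ONE ball B(x₀, rλ), λ
= √(Z/P), in which the near-top-speed set {‖v‖ ≥ (1−δ)M} has volume ≥ c₀(rλ)³. WHY THIS LINE: the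
extremal example mined is the bang-bang structure of exact κ⋆-attainers (landed
`KStar.interior_contact_nonempty`, Theorems/ExtremiserTransienceKStarAttainedContact.lean: an
attainer has a top-speed PLATEAU with non-empty interior). Its quantitative form must be LOCALISED
(one ball of radius rλ — this defeats the copy-invariance crowd/crystal of KEY RISK E0,
HOME/lineL/BC-RECORD.md ADDENDUM 10:36Z: gluing N far-apart copies keeps the efficiency but fakes
any global volume statement) and δ-UNIFORM (∃ c₀ r ∀ δ ∃ ε — this is what makes the plateau EXACT,
of positive measure, in the KNSS zoom limit). It is -/
@[route_item "route-NavierStokesRegularity-ExtremiserTransience"]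
def LocalNearPlateauStability : Prop :=
  ∃ c₀ r : ℝ, 0 < c₀ ∧ 0 < r ∧ ∀ δ : ℝ, 0 < δ → ∃ ε : ℝ, 0 < ε ∧ ∀ (v : EuclideanSpace ℝ (Fin 3) → EuclideanSpace ℝ (Fin 3)) (M B : ℝ), ContDiff ℝ (⊤ : ℕ∞) v → Literature.Analysis.FluidPDE.VectorCalculus.IsDivFree v → (∀ x, ‖v x‖ ≤ M) → (∀ x, ‖fderiv ℝ v x‖ ≤ B) → (∫⁻ x, ‖iteratedFDeriv ℝ 0 v x‖ₑ ^ 2 < ⊤) → (∫⁻ x, ‖iteratedFDeriv ℝ 1 v x‖ₑ ^ 2 < ⊤) → (∫⁻ x, ‖iteratedFDeriv ℝ 2 v x‖ₑ ^ 2 < ⊤) → 0 < M * Real.sqrt (∫ x, ‖Literature.Analysis.FluidPDE.curl v x‖ ^ 2) * Real.sqrt (∫ x, Literature.Analysis.FluidPDE.frobeniusNormSq (fderiv ℝ (Literature.Analysis.FluidPDE.curl v) x)) → (sInf {κ : ℝ | (∀ (v : EuclideanSpace ℝ (Fin 3) → EuclideanSpace ℝ (Fin 3)) (M B : ℝ),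 ContDiff ℝ (⊤ : ℕ∞) v → Literature.Analysis.FluidPDE.VectorCalculus.IsDivFree v → (∀ x, ‖v x‖ ≤ M) → (∀ x, ‖fderiv ℝ v x‖ ≤ B) → (∫⁻ x, ‖iteratedFDeriv ℝ 0 v x‖ₑ ^ 2 < ⊤) → (∫⁻ x, ‖iteratedFDeriv ℝ 1 v x‖ₑ ^ 2 < ⊤) → (∫⁻ x, ‖iteratedFDeriv ℝ 2 v x‖ₑ ^ 2 < ⊤) → |∫ x, ⟪Literature.Analysis.FluidPDE.curl v x, fderiv ℝ v x (Literature.Analysis.FluidPDE.curl v x)⟫_ℝ| ≤ κ * M * Real.sqrt (∫ x, ‖Literature.Analysis.FluidPDE.curl v x‖ ^ 2) * Real.sqrt (∫ x, Literature.Analysis.FluidPDE.frobeniusNormSq (fderiv ℝ (Literature.Analysis.FluidPDE.curl v) x)))} - ε) * M * Real.sqrt (∫ x, ‖Literature.Analysis.FluidPDE.curl v x‖ ^ 2) * Real.sqrt (∫ x, Literature.Analysis.FluidPDE.frobeniusNormSq (fderiv ℝ (Literature.Analysis.FluidPDE.curl v) x)) ≤ |∫ x, ⟪Literature.Analysis.FluidPDE.curl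 v x, fderiv ℝ v x (Literature.Analysis.FluidPDE.curl v x)⟫_ℝ| → ∃ x₀ : EuclideanSpace ℝ (Fin 3), ENNReal.ofReal (c₀ * (r * Real.sqrt ((∫ x, ‖Literature.Analysis.FluidPDE.curl v x‖ ^ 2) / (∫ x, Literature.Analysis.FluidPDE.frobeniusNormSq (fderiv ℝ (Literature.Analysis.FluidPDE.curl v) x)))) ^ 3) ≤ MeasureTheory.volume {x : EuclideanSpace ℝ (Fin 3) | x ∈ Metric.ball x₀ (r * Real.sqrt ((∫ x, ‖Literature.Analysis.FluidPDE.curl v x‖ ^ 2) / (∫ x, Literature.Analysis.FluidPDE.frobeniusNormSq (fderiv ℝ (Literature.Analysis.FluidPDE.curl v) x)))) ∧ (1 - δ) * M ≤ ‖v x‖}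

/-- item stmt-NavierStokesRegularity-21885 · support · rank 9 · closed · proved by Summit.NavierStokesRegularity.NavierStokesRegularity.Theorems.extremiserTransience_averagedRung_proof (prover) · by planner
sources: Leray1934, LemarieRieusset2016, RobinsonRodrigoSadowski2016
[support] MEAN-FORM RUNG (provable on the landed chain `lintegral_curl_sq_le_exp_of_flowwise_coeff`
+ `hasSmoothExtensionPast_of_powerRate`, pattern of `rung_of_eventualDepletion`): if 0 ≤ r, 0 < C,
rC < 1 and a classical Leray–Hopf rapidly-decaying-datum solution on [0,T) with eventual rate C
admits from some onset t₁ a measurable flow-wise depletion coefficient k ∈ [0,1] whose weighted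
square integral ∫_(t₁)^t k²dτ/(T−τ) is at most r² log((T−t₁)/(T−t)) + B, then it extends smoothly
past T (enstrophy exponent r²C²/2 < 1/2 against Leray's H¹ rate). [difficulty: L] -/
@[route_item "route-NavierStokesRegularity-ExtremiserTransience"]
def AveragedRung : Prop :=
  ∀ (r C ν T : ℝ), 0 ≤ r → 0 < C → r * C < 1 → 0 < ν → 0 < T → ∀ (u : ℝ → EuclideanSpace ℝ (Fin 3) → EuclideanSpace ℝ (Fin 3)) (p : ℝ → EuclideanSpace ℝ (Fin 3) → ℝ), Literature.Analysis.FluidPDE.IsClassicalNSSolutionOn (Set.Ico 0 T) ν 0 u p → Literature.Analysis.FluidPDE.IsLerayHopfOn T ν 0 (u 0) u → Literature.Analysis.FluidPDE.HasRapidSpatialDecay (u 0) → (∀ᶠ t in 𝓝[<] T, ∀ x, Real.sqrt (T - t) * ‖u t x‖ ≤ C * Real.sqrt ν) → (∃ t₁ ∈ Set.Ico 0 T, ∃ (k : ℝ → ℝ) (B : ℝ), Measurable k ∧ (∀ τ, 0 ≤ k τ ∧ k τ ≤ 1) ∧ (∀ t ∈ Set.Ico t₁ T, ∀ M : ℝ,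 (∀ x, ‖u t x‖ ≤ M) → |∫ x, ⟪Literature.Analysis.FluidPDE.curl (u t) x, fderiv ℝ (u t) x (Literature.Analysis.FluidPDE.curl (u t) x)⟫_ℝ| ≤ k t * M * Real.sqrt (∫ x, ‖Literature.Analysis.FluidPDE.curl (u t) x‖ ^ 2) * Real.sqrt (∫ x, Literature.Analysis.FluidPDE.frobeniusNormSq (fderiv ℝ (Literature.Analysis.FluidPDE.curl (u t)) x))) ∧ (∀ t ∈ Set.Ico t₁ T, ∫ τ in t₁..t, k τ ^ 2 / (T - τ) ≤ (r) ^ 2 * Real.log ((T - t₁) / (T - t)) + B)) → Literature.Analysis.FluidPDE.HasSmoothExtensionPast ν 0 u T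

-- `AveragedRung` holds: proved by `Summit.NavierStokesRegularity.NavierStokesRegularity.Theorems.extremiserTransience_averagedRung_proof` (its module imports this route file, so no `_holds` link can be stated here).

/-- item stmt-NavierStokesRegularity-24370 · support · rank 9 · open · by planner
why it might fail: Decision point: upper-semicontinuity of the cubic J under weak limits at fixed ‖v‖∞=1, ‖ω‖₂=1 — needs local strong H¹ convergence of ω, but B and ‖D²v‖₂ are free in the ∃ (no uniform tightness). Dichotomy harmless (ratio splitting-neutral), vanishing killed by normalisation. Not in print.
sources: Theorems/ExtremiserTransienceNearExtremalTransienceDSSPerFlow.lean (hna), Theorems/ExtremiserTransienceNearExtremalTransienceSharpConstant.lean (sharpDepletion_is_universal), idea-crit-3 READ 2026-08-28T01:25:26Z, LuDoering2008, AyalaProtas2017, Lions1984 concentration-compactness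
[support] BC5 rung of NearExtremalTransience (21883), KEY-NS #18(iii): the sharp depletion constant
kappa* = sInf V is ATTAINED — some admissible field v (C^infty, div-free, |v| <= M, bounded
gradient, D0 D1 D2 v in L2, M |omega|_2 |grad omega|_2 > 0) realises equality |int <omega, Dv
omega>| = kappa* M |omega|_2 |grad omega|_2. Exactly the negation of et-p1 g2's non-attainment
hypothesis hna (Theorems/ExtremiserTransienceNearExtremalTransienceDSSPerFlow.lean) by universality
of kappa* (sharpDepletion_is_universal); equivalence kernel-checked in
pub/ideators/ns-idea-5/lineI/KStarAttainedScratch.lean (kStarAttained_iff_not_notAttained, rc 0).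
Either truth value is informative: NOT attained => theta_u < 1 on every DSS flow
(dss_perFlow_logMean_of_notAttained, landed); attained => names the maximiser orbit a DSS Type-I
profile must sit on at a.e. phase (DSSDichotomy/DSSOrbit, landed). Why it might fail (either way):
maximising sequences for R = |J|/(M |omega|_2 |grad omega|_2) may lose compactness along the
scaling/translation orbit (vanishing/dichotomy) — concentration-compactness / profile decomposition
needed; the sup-norm constraint |v| <= M makes the functional non-smooth (M ente -/
@[route_item "route-NavierStokesRegularity-ExtremiserTransience"]
def KStarAttained : Prop :=
  ∃ (v : EuclideanSpace ℝ (Fin 3) → EuclideanSpace ℝ (Fin 3)) (M B : ℝ), ContDiff ℝ (⊤ : ℕ∞) v ∧ Literature.Analysis.FluidPDE.VectorCalculus.IsDivFree v ∧ (∀ x, ‖v x‖ ≤ M) ∧ (∀ x, ‖fderiv ℝ v x‖ ≤ B) ∧ (∫⁻ x, ‖iteratedFDeriv ℝ 0 v x‖ₑ ^ 2 < ⊤) ∧ (∫⁻ x, ‖iteratedFDeriv ℝ 1 v x‖ₑ ^ 2 < ⊤) ∧ (∫⁻ x, ‖iteratedFDeriv ℝ 2 v x‖ₑ ^ 2 <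 ⊤) ∧ 0 < M * Real.sqrt (∫ x, ‖Literature.Analysis.FluidPDE.curl v x‖ ^ 2) * Real.sqrt (∫ x, Literature.Analysis.FluidPDE.frobeniusNormSq (fderiv ℝ (Literature.Analysis.FluidPDE.curl v) x)) ∧ |∫ x, ⟪Literature.Analysis.FluidPDE.curl v x, fderiv ℝ v x (Literature.Analysis.FluidPDE.curl v x)⟫_ℝ| = sInf {κ : ℝ | (∀ (v : EuclideanSpace ℝ (Fin 3) → EuclideanSpace ℝ (Fin 3)) (M B : ℝ), ContDiff ℝ (⊤ : ℕ∞) v → Literature.Analysis.FluidPDE.VectorCalculus.IsDivFree v → (∀ x, ‖v x‖ ≤ M) → (∀ x, ‖fderiv ℝ v x‖ ≤ B) → (∫⁻ x, ‖iteratedFDeriv ℝ 0 v x‖ₑ ^ 2 < ⊤) → (∫⁻ x, ‖iteratedFDeriv ℝ 1 v x‖ₑ ^ 2 < ⊤) → (∫⁻ x, ‖iteratedFDeriv ℝ 2 v x‖ₑ ^ 2 < ⊤) → |∫ x, ⟪Literature.Analysis.FluidPDE.curl v x, fderiv ℝ v x (Literature.Analysis.FluidPDE.curl v x)⟫_ℝ|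 ≤ κ * M * Real.sqrt (∫ x, ‖Literature.Analysis.FluidPDE.curl v x‖ ^ 2) * Real.sqrt (∫ x, Literature.Analysis.FluidPDE.frobeniusNormSq (fderiv ℝ (Literature.Analysis.FluidPDE.curl v) x)))} * M * Real.sqrt (∫ x, ‖Literature.Analysis.FluidPDE.curl v x‖ ^ 2) * Real.sqrt (∫ x, Literature.Analysis.FluidPDE.frobeniusNormSq (fderiv ℝ (Literature.Analysis.FluidPDE.curl v) x))

/-- item stmt-NavierStokesRegularity-26568 · support · rank 9 · SPLIT (gen 1) into NoQuantumSheet, SheetOrTangent + glue TangentOfSheet · direct attempts still welcome (low priority) · by planner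
sources: KNSS2009, LuDoering2008, Cruxes/NearExtremalTransience/Lines/extremiser_liouville.md
[support] LINE g4-α obligation K2-per-flow `TangentExtremalExtraction` (ns-idea-5 g4): for ONE
classical Leray–Hopf rapidly-decaying-datum flow with eventual rate √(T−t)|u| ≤ C√ν not extending
past T, if NO exponent θ_u<1 works (negation of the per-flow conclusion, verbatim), an EXTREMAL
ANCIENT SOLUTION exists (KNSS blow-up limit W, Oseen-mild, slices κ⋆-efficient for a.e. time of an
interval; object shared with K2/K1 of Lines/extremiser_liouville and NoExtremalAncient 26569); with
26569 it gives 26567 (composition kernel-checked). SKELETON HOME/lineL/SketchV3e.lean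
(pub/ideators/ns-idea-5; rc 0; sorries 2 = stub_extraction_of_lock, stub_noExtremalAncientPM).
DYNAMIC HALF = TREE THEOREM `PerFlow.scaleLock_at_nearEfficient_times` (p625112): no per-flow
certificate ⇒ ∀ε>0 ∀t₁<T the (κ⋆−ε)-efficient times with c₁ν(T−t)P ≤ Z ≤ c₂ν(T−t)P are NON-NULL
(with S1 p623789, p620874, p619570, p618586; piece selection p624628/p624802). KEY RISK (E0), READ
HOME/lineL/BC-RECORD.md ADDENDUM 10:36Z: R=J/(M√Z√P) is COPY-INVARIANT ⇒ the number of locked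
near-extremal bumps (one Leray quantum C²ν^{3/2}/√(T−t) each) is bounded only by
(T−t)^{1/2−κ⋆²C²/2}, unbounded when κ⋆C>1; a clustering crystal giv -/
@[route_item "route-NavierStokesRegularity-ExtremiserTransience"]
def TangentExtremalExtraction : Prop :=
  ∀ (C ν T : ℝ), 0 < C → 0 < ν → 0 < T → ∀ (u : ℝ → EuclideanSpace ℝ (Fin 3) → EuclideanSpace ℝ (Fin 3)) (p : ℝ → EuclideanSpace ℝ (Fin 3) → ℝ), Literature.Analysis.FluidPDE.IsClassicalNSSolutionOn (Set.Ico 0 T) ν 0 u p → Literature.Analysis.FluidPDE.IsLerayHopfOn T ν 0 (u 0) u → Literature.Analysis.FluidPDE.HasRapidSpatialDecay (u 0) → (∀ᶠ t in 𝓝[<] T, ∀ x, Real.sqrt (T - t) * ‖u t x‖ ≤ C * Real.sqrt ν) → ¬ Literature.Analysis.FluidPDE.HasSmoothExtensionPast ν 0 u T → ¬ (∃ θ : ℝ, 0 ≤ θ ∧ θ < 1 ∧ ∀ κ : ℝ, (∀ (v : EuclideanSpace ℝ (Fin 3) → EuclideanSpace ℝ (Fin 3)) (M B : ℝ), ContDiff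 ℝ (⊤ : ℕ∞) v → Literature.Analysis.FluidPDE.VectorCalculus.IsDivFree v → (∀ x, ‖v x‖ ≤ M) → (∀ x, ‖fderiv ℝ v x‖ ≤ B) → (∫⁻ x, ‖iteratedFDeriv ℝ 0 v x‖ₑ ^ 2 < ⊤) → (∫⁻ x, ‖iteratedFDeriv ℝ 1 v x‖ₑ ^ 2 < ⊤) → (∫⁻ x, ‖iteratedFDeriv ℝ 2 v x‖ₑ ^ 2 < ⊤) → |∫ x, ⟪Literature.Analysis.FluidPDE.curl v x, fderiv ℝ v x (Literature.Analysis.FluidPDE.curl v x)⟫_ℝ| ≤ κ * M * Real.sqrt (∫ x, ‖Literature.Analysis.FluidPDE.curl v x‖ ^ 2) * Real.sqrt (∫ x, Literature.Analysis.FluidPDE.frobeniusNormSq (fderiv ℝ (Literature.Analysis.FluidPDE.curl v) x))) → ∃ t₁ ∈ Set.Ico 0 T, ∃ (k : ℝ → ℝ) (B : ℝ), Measurable k ∧ (∀ τ, 0 ≤ k τ ∧ k τ ≤ 1) ∧ (∀ t ∈ Set.Ico t₁ T, ∀ M : ℝ, (∀ x, ‖u t x‖ ≤ M) → |∫ x,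 ⟪Literature.Analysis.FluidPDE.curl (u t) x, fderiv ℝ (u t) x (Literature.Analysis.FluidPDE.curl (u t) x)⟫_ℝ| ≤ k t * M * Real.sqrt (∫ x, ‖Literature.Analysis.FluidPDE.curl (u t) x‖ ^ 2) * Real.sqrt (∫ x, Literature.Analysis.FluidPDE.frobeniusNormSq (fderiv ℝ (Literature.Analysis.FluidPDE.curl (u t)) x))) ∧ (∀ t ∈ Set.Ico t₁ T, ∫ τ in t₁..t, k τ ^ 2 / (T - τ) ≤ (θ * κ) ^ 2 * Real.log ((T - t₁) / (T - t)) + B)) → ∃ (W : ℝ → EuclideanSpace ℝ (Fin 3) → EuclideanSpace ℝ (Fin 3)) (a b : ℝ), (Literature.Analysis.FluidPDE.IsKNSSBlowupLimit W ∧ (∀ s t : ℝ, s < t → t < 0 → ∀ x, W t x = Literature.Analysis.FluidPDE.heatFlow (W s) (t - s) x - Literature.Analysis.FluidPDE.oseenDuhamel 1 s W W t x)) ∧ a < b ∧ b ≤ 0 ∧ ∀ᵐ t : ℝ, t ∈ Set.Ioo a b → (ContDiff ℝ (⊤ : ℕ∞) (W t) ∧ Literature.Analysis.FluidPDE.VectorCalculus.IsDivFree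 (W t) ∧ (∃ B : ℝ, ∀ x, ‖fderiv ℝ (W t) x‖ ≤ B) ∧ (∫⁻ x, ‖iteratedFDeriv ℝ 1 (W t) x‖ₑ ^ 2 < ⊤) ∧ (∫⁻ x, ‖iteratedFDeriv ℝ 2 (W t) x‖ₑ ^ 2 < ⊤) ∧ ∃ M : ℝ, (∀ x, ‖(W t) x‖ ≤ M) ∧ 0 < M * Real.sqrt (∫ x, ‖Literature.Analysis.FluidPDE.curl (W t) x‖ ^ 2) * Real.sqrt (∫ x, Literature.Analysis.FluidPDE.frobeniusNormSq (fderiv ℝ (Literature.Analysis.FluidPDE.curl (W t)) x)) ∧ (sInf {κ : ℝ | (∀ (v : EuclideanSpace ℝ (Fin 3) → EuclideanSpace ℝ (Fin 3)) (M B : ℝ), ContDiff ℝ (⊤ : ℕ∞) v → Literature.Analysis.FluidPDE.VectorCalculus.IsDivFree v → (∀ x, ‖v x‖ ≤ M) → (∀ x, ‖fderiv ℝ v x‖ ≤ B) → (∫⁻ x, ‖iteratedFDeriv ℝ 0 v x‖ₑ ^ 2 < ⊤) → (∫⁻ x, ‖iteratedFDeriv ℝ 1 v x‖ₑ ^ 2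 < ⊤) → (∫⁻ x, ‖iteratedFDeriv ℝ 2 v x‖ₑ ^ 2 < ⊤) → |∫ x, ⟪Literature.Analysis.FluidPDE.curl v x, fderiv ℝ v x (Literature.Analysis.FluidPDE.curl v x)⟫_ℝ| ≤ κ * M * Real.sqrt (∫ x, ‖Literature.Analysis.FluidPDE.curl v x‖ ^ 2) * Real.sqrt (∫ x, Literature.Analysis.FluidPDE.frobeniusNormSq (fderiv ℝ (Literature.Analysis.FluidPDE.curl v) x)))}) * M * Real.sqrt (∫ x, ‖Literature.Analysis.FluidPDE.curl (W t) x‖ ^ 2) * Real.sqrt (∫ x, Literature.Analysis.FluidPDE.frobeniusNormSq (fderiv ℝ (Literature.Analysis.FluidPDE.curl (W t)) x)) ≤ |∫ x, ⟪Literature.Analysis.FluidPDE.curl (W t) x, fderiv ℝ (W t) x (Literature.Analysis.FluidPDE.curl (W t) x)⟫_ℝ|)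

-- parent: TangentExtremalExtraction · child (gen 1)
/--     item stmt-NavierStokesRegularity-27695 · crux · rank 901 · open
    parent: TangentExtremalExtraction · by planner
    why it might fail: A doubly-periodic array of near-extremal quanta may be dynamically self-consistent: a Type-I ancient ‘sheet of quanta’ (Kelvin–Helmholtz-type lattice) is excluded by no known Liouville theorem (KNSS 2009 needs 2D/axisymmetry), and windowing can even raise the efficiency above κ⋆.
    sources: KochNadirashviliSereginSverak2009, KNSS2009, SereginSverak2009, Lions1984, ESS2003, Tsai1998
[crux · LINE g5-β «quantum sheet» (ns-idea-5 g5, technique: extremal-example mining) part 1/2 ·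
dynamic rigidity · size XL] NO QUANTUM-SHEET ELEMENT: there is no Oseen-mild KNSS blow-up limit W
(Literature IsKNSSBlowupLimit: bounded ancient mild, smooth, |W| ≤ 1 = sup) with backward Type-I
decay √(−t)‖W(t)‖_∞ ≤ K whose slices, for a positive-measure set of times in some (a,b), b ≤ 0, are
smooth, divergence free, of bounded gradient, of INFINITE enstrophy and ASYMPTOTICALLY κ⋆-EFFICIENT
ON LARGE BALLS: |J_{B(0,ρ_k)}| ≥ (κ⋆ − ε_k)·M·√Z_{B(0,ρ_k)}·√P_{B(0,ρ_k)}, ρ_k → ∞, ε_k → 0, M ≥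
sup|W(t)| (κ⋆ = the sInf constant of NearExtremalTransience; J, Z, P =
stretching/enstrophy/palinstrophy integrals over the ball; all integrands continuous on the closed
ball, no junk values). WHY THIS LINE: the extremal ENEMY mined is the Leray-quantum SHEET. R =
J/(M√Z√P) is invariant under gluing far-apart copies (KEY RISK E0 of LINE g4-α,
HOME/lineL/BC-RECORD.md ADDENDUM 10:36Z; the tree's N³-array `testField` of
Theorems/…ExtremiserLiouvilleArrayField.lean is such a crowd), so the KNSS zoom at scale-locked
near-efficient times (p625112) may see infinitely many quanta: a slice of infinite enstrophy, o -/
@[route_item "route-NavierStokesRegularity-ExtremiserTransience"]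
def NoQuantumSheet : Prop :=
  ¬ ∃ (W : ℝ → EuclideanSpace ℝ (Fin 3) → EuclideanSpace ℝ (Fin 3)) (K a b : ℝ), (Literature.Analysis.FluidPDE.IsKNSSBlowupLimit W ∧ (∀ s t : ℝ, s < t → t < 0 → ∀ x, W t x = Literature.Analysis.FluidPDE.heatFlow (W s) (t - s) x - Literature.Analysis.FluidPDE.oseenDuhamel 1 s W W t x)) ∧ (∀ t : ℝ, t < 0 → ∀ x, Real.sqrt (-t) * ‖W t x‖ ≤ K) ∧ a < b ∧ b ≤ 0 ∧ 0 < MeasureTheory.volume {t : ℝ | t ∈ Set.Ioo a b ∧ (ContDiff ℝ (⊤ : ℕ∞) (W t) ∧ Literature.Analysis.FluidPDE.VectorCalculus.IsDivFree (W t) ∧ (∃ B : ℝ, ∀ x, ‖fderiv ℝ (W t) x‖ ≤ B) ∧ ¬ (∫⁻ x, ‖Literature.Analysis.FluidPDE.curl (W t) x‖ₑ ^ 2 < ⊤) ∧ ∃ (M : ℝ) (ρ ε : ℕ → ℝ), (∀ x, ‖W t x‖ ≤ M) ∧ Filter.Tendsto ρ Filter.atTop Filter.atTop ∧ Filter.Tendsto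 ε Filter.atTop (nhds 0) ∧ ∀ k : ℕ, (sInf {κ : ℝ | (∀ (v : EuclideanSpace ℝ (Fin 3) → EuclideanSpace ℝ (Fin 3)) (M B : ℝ), ContDiff ℝ (⊤ : ℕ∞) v → Literature.Analysis.FluidPDE.VectorCalculus.IsDivFree v → (∀ x, ‖v x‖ ≤ M) → (∀ x, ‖fderiv ℝ v x‖ ≤ B) → (∫⁻ x, ‖iteratedFDeriv ℝ 0 v x‖ₑ ^ 2 < ⊤) → (∫⁻ x, ‖iteratedFDeriv ℝ 1 v x‖ₑ ^ 2 < ⊤) → (∫⁻ x, ‖iteratedFDeriv ℝ 2 v x‖ₑ ^ 2 < ⊤) → |∫ x, ⟪Literature.Analysis.FluidPDE.curl v x, fderiv ℝ v x (Literature.Analysis.FluidPDE.curl v x)⟫_ℝ| ≤ κ * M * Real.sqrt (∫ x, ‖Literature.Analysis.FluidPDE.curl v x‖ ^ 2) * Real.sqrt (∫ x, Literature.Analysis.FluidPDE.frobeniusNormSq (fderiv ℝ (Literature.Analysis.FluidPDE.curl v) x)))} - ε k) * M * Real.sqrt (∫ x in Metric.ball (0 : EuclideanSpace ℝ (Fin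 3)) (ρ k), ‖Literature.Analysis.FluidPDE.curl (W t) x‖ ^ 2) * Real.sqrt (∫ x in Metric.ball (0 : EuclideanSpace ℝ (Fin 3)) (ρ k), Literature.Analysis.FluidPDE.frobeniusNormSq (fderiv ℝ (Literature.Analysis.FluidPDE.curl (W t)) x)) ≤ |∫ x in Metric.ball (0 : EuclideanSpace ℝ (Fin 3)) (ρ k), ⟪Literature.Analysis.FluidPDE.curl (W t) x, fderiv ℝ (W t) x (Literature.Analysis.FluidPDE.curl (W t) x)⟫_ℝ|)}

-- parent: TangentExtremalExtraction · child (gen 1)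
/--     item stmt-NavierStokesRegularity-27696 · support · rank 902 · open
    parent: TangentExtremalExtraction · by planner
    why it might fail: Branch (c) needs uniform o(1) control of inter-piece cross terms of J, Z, P on growing windows (dipole tails between div-free pieces) and the (E2) persistence-of-efficiency estimate on windows of length ≍ λ², neither yet in the tree.
    sources: KNSS2009, Lions1984, SereginSverak2009, Leray1934, ESS2003, Summits/NavierStokesRegularity/NavierStokesRegularity/Theorems/ExtremiserTransiencePerFlowScaleLock.lean
[support · LINE g5-β «quantum sheet» · child of 26568 · rev-19 NOTE answering critic prices Q1–Q3
(idea-crit-3 11:50Z, adopted idea-crit-4 11:54Z)] SHEET-OR-TANGENT DICHOTOMY: for every Type-I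
non-extendable classical flow with no depletion certificate, EITHER 26568's exact-extremal
finite-enstrophy tangent object exists OR ¬NoQuantumSheet (a Leray-quantum sheet tangent object
exists). (Q1 — centre selection) NO TIGHTNESS IS OWED: `IsKNSSBlowupLimit` is an intrinsic class, so
the zoom FOLLOWS the bulk quantum — centre (xₙ, τₙ⁺) at a near-efficient scale-locked time τₙ with
xₙ a centre of a Taylor-scale ball carrying a fixed fraction of the windowed efficiency budget
(Lions selection at scale λ(τₙ) = √(Z/P) ≍ √(ν(T−τₙ)), two-sided lock landed p625112), amplitude =
running max of ‖u‖ on [0, τₙ⁺] (so |Uₙ| ≤ 1 for rescaled s < 0) — exactly as in the α-repair item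
PlateauSliceTransfer (27822); wandering or hopping sites are harmless because each zoom is
re-centred. (Q3 — the energy-per-ball lemma this item relies on, now typed as the core of
PlateauSliceRigidity 27823): for a continuous Oseen-mild ancient field with √(−t)‖W t x‖ ≤ K one has
∫_{B_ρ}‖W(t)‖² ≤ C(K)ρ²/√(−t) for all ρ > 0, t -/
@[route_item "route-NavierStokesRegularity-ExtremiserTransience"]
def SheetOrTangent : Prop :=
  ∀ (C ν T : ℝ), 0 < C → 0 < ν → 0 < T → ∀ (u : ℝ → EuclideanSpace ℝ (Fin 3) → EuclideanSpace ℝ (Fin 3)) (p : ℝ → EuclideanSpace ℝ (Fin 3) → ℝ), Literature.Analysis.FluidPDE.IsClassicalNSSolutionOn (Set.Ico 0 T) ν 0 u p → Literature.Analysis.FluidPDE.IsLerayHopfOn T ν 0 (u 0) u → Literature.Analysis.FluidPDE.HasRapidSpatialDecay (u 0) → (∀ᶠ t in 𝓝[<] T, ∀ x, Real.sqrt (T - t) * ‖u t x‖ ≤ C * Real.sqrt ν) → ¬ Literature.Analysis.FluidPDE.HasSmoothExtensionPast ν 0 u T → ¬ (∃ θ : ℝ, 0 ≤ θ ∧ θ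 < 1 ∧ ∀ κ : ℝ, (∀ (v : EuclideanSpace ℝ (Fin 3) → EuclideanSpace ℝ (Fin 3)) (M B : ℝ), ContDiff ℝ (⊤ : ℕ∞) v → Literature.Analysis.FluidPDE.VectorCalculus.IsDivFree v → (∀ x, ‖v x‖ ≤ M) → (∀ x, ‖fderiv ℝ v x‖ ≤ B) → (∫⁻ x, ‖iteratedFDeriv ℝ 0 v x‖ₑ ^ 2 < ⊤) → (∫⁻ x, ‖iteratedFDeriv ℝ 1 v x‖ₑ ^ 2 < ⊤) → (∫⁻ x, ‖iteratedFDeriv ℝ 2 v x‖ₑ ^ 2 < ⊤) → |∫ x, ⟪Literature.Analysis.FluidPDE.curl v x, fderiv ℝ v x (Literature.Analysis.FluidPDE.curl v x)⟫_ℝ| ≤ κ * M * Real.sqrt (∫ x, ‖Literature.Analysis.FluidPDE.curl v x‖ ^ 2) * Real.sqrt (∫ x, Literature.Analysis.FluidPDE.frobeniusNormSq (fderiv ℝ (Literature.Analysis.FluidPDE.curl v) x))) → ∃ t₁ ∈ Set.Ico 0 T, ∃ (k : ℝ → ℝ) (B : ℝ), Measurable k ∧ (∀ τ, 0 ≤ k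 τ ∧ k τ ≤ 1) ∧ (∀ t ∈ Set.Ico t₁ T, ∀ M : ℝ, (∀ x, ‖u t x‖ ≤ M) → |∫ x, ⟪Literature.Analysis.FluidPDE.curl (u t) x, fderiv ℝ (u t) x (Literature.Analysis.FluidPDE.curl (u t) x)⟫_ℝ| ≤ k t * M * Real.sqrt (∫ x, ‖Literature.Analysis.FluidPDE.curl (u t) x‖ ^ 2) * Real.sqrt (∫ x, Literature.Analysis.FluidPDE.frobeniusNormSq (fderiv ℝ (Literature.Analysis.FluidPDE.curl (u t)) x))) ∧ (∀ t ∈ Set.Ico t₁ T, ∫ τ in t₁..t, k τ ^ 2 / (T - τ) ≤ (θ * κ) ^ 2 * Real.log ((T - t₁) / (T - t)) + B)) → (∃ (W : ℝ → EuclideanSpace ℝ (Fin 3) → EuclideanSpace ℝ (Fin 3)) (a b : ℝ), (Literature.Analysis.FluidPDE.IsKNSSBlowupLimit W ∧ (∀ s t : ℝ, s < t → t < 0 → ∀ x, W t x = Literature.Analysis.FluidPDE.heatFlow (W s) (t - s) x - Literature.Analysis.FluidPDE.oseenDuhamel 1 s W W t x)) ∧ a < b ∧ b ≤ 0 ∧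 ∀ᵐ t : ℝ, t ∈ Set.Ioo a b → (ContDiff ℝ (⊤ : ℕ∞) (W t) ∧ Literature.Analysis.FluidPDE.VectorCalculus.IsDivFree (W t) ∧ (∃ B : ℝ, ∀ x, ‖fderiv ℝ (W t) x‖ ≤ B) ∧ (∫⁻ x, ‖iteratedFDeriv ℝ 1 (W t) x‖ₑ ^ 2 < ⊤) ∧ (∫⁻ x, ‖iteratedFDeriv ℝ 2 (W t) x‖ₑ ^ 2 < ⊤) ∧ ∃ M : ℝ, (∀ x, ‖(W t) x‖ ≤ M) ∧ 0 < M * Real.sqrt (∫ x, ‖Literature.Analysis.FluidPDE.curl (W t) x‖ ^ 2) * Real.sqrt (∫ x, Literature.Analysis.FluidPDE.frobeniusNormSq (fderiv ℝ (Literature.Analysis.FluidPDE.curl (W t)) x)) ∧ (sInf {κ : ℝ | (∀ (v : EuclideanSpace ℝ (Fin 3) → EuclideanSpace ℝ (Fin 3)) (M B : ℝ), ContDiff ℝ (⊤ : ℕ∞) v → Literature.Analysis.FluidPDE.VectorCalculus.IsDivFree v → (∀ x, ‖v x‖ ≤ M) → (∀ x, ‖fderiv ℝ v x‖ ≤ B)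 → (∫⁻ x, ‖iteratedFDeriv ℝ 0 v x‖ₑ ^ 2 < ⊤) → (∫⁻ x, ‖iteratedFDeriv ℝ 1 v x‖ₑ ^ 2 < ⊤) → (∫⁻ x, ‖iteratedFDeriv ℝ 2 v x‖ₑ ^ 2 < ⊤) → |∫ x, ⟪Literature.Analysis.FluidPDE.curl v x, fderiv ℝ v x (Literature.Analysis.FluidPDE.curl v x)⟫_ℝ| ≤ κ * M * Real.sqrt (∫ x, ‖Literature.Analysis.FluidPDE.curl v x‖ ^ 2) * Real.sqrt (∫ x, Literature.Analysis.FluidPDE.frobeniusNormSq (fderiv ℝ (Literature.Analysis.FluidPDE.curl v) x)))}) * M * Real.sqrt (∫ x, ‖Literature.Analysis.FluidPDE.curl (W t) x‖ ^ 2) * Real.sqrt (∫ x, Literature.Analysis.FluidPDE.frobeniusNormSq (fderiv ℝ (Literature.Analysis.FluidPDE.curl (W t)) x)) ≤ |∫ x, ⟪Literature.Analysis.FluidPDE.curl (W t) x, fderiv ℝ (W t) x (Literature.Analysis.FluidPDE.curl (W t) x)⟫_ℝ|)) ∨ (¬ NoQuantumSheet)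

-- parent: TangentExtremalExtraction · glue (gen 1)
/--     item stmt-NavierStokesRegularity-27697 · support · rank 903 · closed · proved by Summit.NavierStokesRegularity.NavierStokesRegularity.Theses.ExtremiserTransience.tangentOfSheet (planner)
    parent: TangentExtremalExtraction · GLUE: children ⟹ parent · by planner
LINE g5-β «quantum sheet» (ns-idea-5 g5): TangentExtremalExtraction (26568) ⇐ NoQuantumSheet ∧
SheetOrTangent — pure logic by cases, since SheetOrTangent := (…26568's hypotheses…) → (26568's
object) ∨ ¬NoQuantumSheet; kernel-checked as SheetV1.tee_of_sheet in the seat's lineO/Sketch.lean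
(rc 0, 0 sorries): intro the 14 binders, rcases hS … with hA | hB; exact hA; exact (hB hN).elim -/
@[route_item "route-NavierStokesRegularity-ExtremiserTransience"]
def TangentOfSheet : Prop :=
  NoQuantumSheet → SheetOrTangent → TangentExtremalExtraction

-- `TangentOfSheet` holds: proved by `Summit.NavierStokesRegularity.NavierStokesRegularity.Theses.ExtremiserTransience.tangentOfSheet` (its module imports this route file, so no `_holds` link can be stated here).

/-- item stmt-NavierStokesRegularity-26569 · support · rank 9 · open · by planner
sources: KNSS2009, Cruxes/NearExtremalTransience/Lines/extremiser_liouville.md, Theorems/ExtremiserTransienceKStarAttainedContact.lean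
[support] LINE g4-α obligation K1 `NoExtremalAncient` (stub_noExtremalAncient of lineL/Sketch.lean;
SHARED with ns-idea-10's line extremiser_liouville on 21883, where `extremalAncient_false_of` proves
it modulo K1a `stub_analyticSlices` (slices of Oseen-mild KNSS limits are real-analytic: Masuda 1967
/ Giga–Sawada 2003; tree OseenSchemeRealAnalytic, typeI_mild_analyticOnNhd) and K1b
`stub_noAnalyticExtremal` (no real-analytic admissible field WITHOUT the L² clause is κ⋆-efficient:
re-run of the landed plateau theorem KStar.not_attained_of_analyticOnNhd in the homogeneous class)):
there is NO extremal ancient solution. Either line closing it serves both. Why it might fail: K1b —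
a (−1)-homogeneous-type analytic profile with ω ∈ Ḣ⁰ ∩ Ḣ¹ but v ∉ L² could be κ⋆-efficient (the
plateau argument uses the L² tail only to place the contact set). [difficulty: L] -/
@[route_item "route-NavierStokesRegularity-ExtremiserTransience"]
def NoExtremalAncient : Prop :=
  ¬ ∃ (W : ℝ → EuclideanSpace ℝ (Fin 3) → EuclideanSpace ℝ (Fin 3)) (a b : ℝ), (Literature.Analysis.FluidPDE.IsKNSSBlowupLimit W ∧ (∀ s t : ℝ, s < t → t < 0 → ∀ x, W t x = Literature.Analysis.FluidPDE.heatFlow (W s) (t - s) x - Literature.Analysis.FluidPDE.oseenDuhamel 1 s W W t x)) ∧ a < b ∧ b ≤ 0 ∧ ∀ᵐ t : ℝ, t ∈ Set.Ioo a b → (ContDiff ℝ (⊤ : ℕ∞) (W t) ∧ Literature.Analysis.FluidPDE.VectorCalculus.IsDivFree (W t) ∧ (∃ B : ℝ, ∀ x, ‖fderiv ℝ (W t) x‖ ≤ B) ∧ (∫⁻ x, ‖iteratedFDeriv ℝ 1 (W t) x‖ₑ ^ 2 < ⊤) ∧ (∫⁻ x, ‖iteratedFDeriv ℝ 2 (W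 t) x‖ₑ ^ 2 < ⊤) ∧ ∃ M : ℝ, (∀ x, ‖(W t) x‖ ≤ M) ∧ 0 < M * Real.sqrt (∫ x, ‖Literature.Analysis.FluidPDE.curl (W t) x‖ ^ 2) * Real.sqrt (∫ x, Literature.Analysis.FluidPDE.frobeniusNormSq (fderiv ℝ (Literature.Analysis.FluidPDE.curl (W t)) x)) ∧ (sInf {κ : ℝ | (∀ (v : EuclideanSpace ℝ (Fin 3) → EuclideanSpace ℝ (Fin 3)) (M B : ℝ), ContDiff ℝ (⊤ : ℕ∞) v → Literature.Analysis.FluidPDE.VectorCalculus.IsDivFree v → (∀ x, ‖v x‖ ≤ M) → (∀ x, ‖fderiv ℝ v x‖ ≤ B) → (∫⁻ x, ‖iteratedFDeriv ℝ 0 v x‖ₑ ^ 2 < ⊤) → (∫⁻ x, ‖iteratedFDeriv ℝ 1 v x‖ₑ ^ 2 < ⊤) → (∫⁻ x, ‖iteratedFDeriv ℝ 2 v x‖ₑ ^ 2 < ⊤) → |∫ x, ⟪Literature.Analysis.FluidPDE.curl v x, fderiv ℝ v x (Literature.Analysis.FluidPDE.curl v x)⟫_ℝ| ≤ κ * M *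 Real.sqrt (∫ x, ‖Literature.Analysis.FluidPDE.curl v x‖ ^ 2) * Real.sqrt (∫ x, Literature.Analysis.FluidPDE.frobeniusNormSq (fderiv ℝ (Literature.Analysis.FluidPDE.curl v) x)))}) * M * Real.sqrt (∫ x, ‖Literature.Analysis.FluidPDE.curl (W t) x‖ ^ 2) * Real.sqrt (∫ x, Literature.Analysis.FluidPDE.frobeniusNormSq (fderiv ℝ (Literature.Analysis.FluidPDE.curl (W t)) x)) ≤ |∫ x, ⟪Literature.Analysis.FluidPDE.curl (W t) x, fderiv ℝ (W t) x (Literature.Analysis.FluidPDE.curl (W t) x)⟫_ℝ|)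

/-- item stmt-NavierStokesRegularity-26687 · support · rank 9 · closed · proved by Summit.NavierStokesRegularity.NavierStokesRegularity.Theorems.decayingSharpConstant_proof (prover) · by planner
sources: Galdi2011, Theorems/ExtremiserTransienceNearExtremalTransienceSharpConstant.lean
[support] LINE g4-β rung (decaying stratum) `DecayingSharpConstant`: κ⋆ is universal on
homogeneous-class fields that tend to 0 at spatial infinity. Proof plan (L; idea-crit-4 P4 +
idea-crit-7, Lean-cheaper than Bogovskiĭ, which Mathlib lacks): truncate the VECTOR POTENTIAL — v →
0 at infinity with ω ∈ L² gives v = curl A (A = (−Δ)⁻¹ω, Biot–Savart), and v_L := curl(χ_L A) is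
exactly div-free and compactly supported; the ONE lemma is |A(x)| = o(|x|) (from v → 0 with v
bounded: Biot–Savart tail), which makes the corrector ∇χ_L × A = O(sup_(annulus)|A|/L) → 0 uniformly
and the terms ∇²χ_L·A, ∇χ_L·∇A → 0 in the norms entering Z and P (annulus bookkeeping with D¹v, D²v
∈ L², v ∈ L⁶); hence sup|v_L| → sup|v|, J(v_L) → J(v), Z, P converge; apply the landed universality
of κ⋆ on the L² class (`DepletionLadder.sharpDepletion_is_universal`; κ⋆ is a genuine infimum:
`universal_depletion_constant_nonneg`, `sharpDepletion_le_lambSplit`, `sharpDepletion_gt`) to v_L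
and pass to the limit. TRUE on both branches of the Galilean dichotomy and seated FIRST
(critics/director). This is exactly the input a DRIFT-FREE tangent line uses instead of
HomogeneousSharpConstant; it also shows the whole Galilean -/
@[route_item "route-NavierStokesRegularity-ExtremiserTransience"]
def DecayingSharpConstant : Prop :=
  ∀ (v : EuclideanSpace ℝ (Fin 3) → EuclideanSpace ℝ (Fin 3)) (M B : ℝ), ContDiff ℝ (⊤ : ℕ∞) v → Literature.Analysis.FluidPDE.VectorCalculus.IsDivFree v → (∀ x, ‖v x‖ ≤ M) → (∀ x, ‖fderiv ℝ v x‖ ≤ B) → (∫⁻ x, ‖iteratedFDeriv ℝ 1 v x‖ₑ ^ 2 < ⊤) → (∫⁻ x, ‖iteratedFDeriv ℝ 2 v x‖ₑ ^ 2 < ⊤) → Filter.Tendsto v (Filter.cocompact (EuclideanSpace ℝ (Fin 3))) (nhds 0) → |∫ x, ⟪Literature.Analysis.FluidPDE.curl v x, fderiv ℝ v x (Literature.Analysis.FluidPDE.curl v x)⟫_ℝ| ≤ sInf {κ : ℝ | (∀ (v : EuclideanSpace ℝ (Fin 3) → EuclideanSpace ℝ (Fin 3)) (M B : ℝ), ContDiff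 ℝ (⊤ : ℕ∞) v → Literature.Analysis.FluidPDE.VectorCalculus.IsDivFree v → (∀ x, ‖v x‖ ≤ M) → (∀ x, ‖fderiv ℝ v x‖ ≤ B) → (∫⁻ x, ‖iteratedFDeriv ℝ 0 v x‖ₑ ^ 2 < ⊤) → (∫⁻ x, ‖iteratedFDeriv ℝ 1 v x‖ₑ ^ 2 < ⊤) → (∫⁻ x, ‖iteratedFDeriv ℝ 2 v x‖ₑ ^ 2 < ⊤) → |∫ x, ⟪Literature.Analysis.FluidPDE.curl v x, fderiv ℝ v x (Literature.Analysis.FluidPDE.curl v x)⟫_ℝ| ≤ κ * M * Real.sqrt (∫ x, ‖Literature.Analysis.FluidPDE.curl v x‖ ^ 2) * Real.sqrt (∫ x, Literature.Analysis.FluidPDE.frobeniusNormSq (fderiv ℝ (Literature.Analysis.FluidPDE.curl v) x)))} * M * Real.sqrt (∫ x, ‖Literature.Analysis.FluidPDE.curl v x‖ ^ 2) * Real.sqrt (∫ x, Literature.Analysis.FluidPDE.frobeniusNormSq (fderiv ℝ (Literature.Analysis.FluidPDE.curl v) x))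

-- `DecayingSharpConstant` holds: proved by `Summit.NavierStokesRegularity.NavierStokesRegularity.Theorems.decayingSharpConstant_proof` (its module imports this route file, so no `_holds` link can be stated here).

/-- item stmt-NavierStokesRegularity-26688 · support · rank 9 · closed · proved by Summit.NavierStokesRegularity.NavierStokesRegularity.Theorems.galileanGainLeTwo_proof (prover) · by planner
sources: Theorems/ExtremiserTransienceNearExtremalTransienceSharpConstant.lean
[support] LINE g4-β `GalileanGainLeTwo`: a homogeneous-class field with drift c at infinity (v − c →
0) obeys the sharp inequality with constant 2κ⋆. Proof plan (M, from DecayingSharpConstant): apply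
it to v − c (same curl, fderiv, D¹, D²; C^∞; div-free), get |J| ≤ κ⋆‖v − c‖_∞√Z√P, and ‖v − c‖_∞ ≤ M
+ ‖c‖ ≤ 2M because c is a limit of values of norm ≤ M. Quantifies the worst case of the
galilean-gauge dichotomy: re-posing the tangent lines Galilean-invariantly costs at most a factor 2
in the certificate reach. Junk guard (idea-crit-4 P3; discharged in tree, idea-crit-7): κ⋆ = sInf V
is a genuine infimum — cite `DepletionLadder.universal_depletion_constant_nonneg` (BddBelow by 0),
`DepletionLadder.sharpDepletion_le_lambSplit` ((9+2√15)/42 ∈ V), `DepletionLadder.sharpDepletion_gt`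
(13/200 < κ⋆); ‖c‖ ≤ M because `Filter.cocompact (EuclideanSpace ℝ (Fin 3))` is NeBot and c is the
limit of values in the closed M-ball. Seat order (critics/director): after DecayingSharpConstant
(26687). No summit is proved by a line. -/
@[route_item "route-NavierStokesRegularity-ExtremiserTransience"]
def GalileanGainLeTwo : Prop :=
  ∀ (v : EuclideanSpace ℝ (Fin 3) → EuclideanSpace ℝ (Fin 3)) (c : EuclideanSpace ℝ (Fin 3)) (M B : ℝ), ContDiff ℝ (⊤ : ℕ∞) v → Literature.Analysis.FluidPDE.VectorCalculus.IsDivFree v → (∀ x, ‖v x‖ ≤ M) → (∀ x, ‖fderiv ℝ v x‖ ≤ B) → (∫⁻ x, ‖iteratedFDeriv ℝ 1 v x‖ₑ ^ 2 < ⊤) → (∫⁻ x, ‖iteratedFDeriv ℝ 2 v x‖ₑ ^ 2 < ⊤) → Filter.Tendsto (fun x => v x - c) (Filter.cocompact (EuclideanSpace ℝ (Fin 3))) (nhds 0) → |∫ x, ⟪Literature.Analysis.FluidPDE.curl v x, fderiv ℝ v x (Literature.Analysis.FluidPDE.curl v x)⟫_ℝ| ≤ 2 * sInf {κ : ℝ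 | (∀ (v : EuclideanSpace ℝ (Fin 3) → EuclideanSpace ℝ (Fin 3)) (M B : ℝ), ContDiff ℝ (⊤ : ℕ∞) v → Literature.Analysis.FluidPDE.VectorCalculus.IsDivFree v → (∀ x, ‖v x‖ ≤ M) → (∀ x, ‖fderiv ℝ v x‖ ≤ B) → (∫⁻ x, ‖iteratedFDeriv ℝ 0 v x‖ₑ ^ 2 < ⊤) → (∫⁻ x, ‖iteratedFDeriv ℝ 1 v x‖ₑ ^ 2 < ⊤) → (∫⁻ x, ‖iteratedFDeriv ℝ 2 v x‖ₑ ^ 2 < ⊤) → |∫ x, ⟪Literature.Analysis.FluidPDE.curl v x, fderiv ℝ v x (Literature.Analysis.FluidPDE.curl v x)⟫_ℝ| ≤ κ * M * Real.sqrt (∫ x, ‖Literature.Analysis.FluidPDE.curl v x‖ ^ 2) * Real.sqrt (∫ x, Literature.Analysis.FluidPDE.frobeniusNormSq (fderiv ℝ (Literature.Analysis.FluidPDE.curl v) x)))} * M * Real.sqrt (∫ x, ‖Literature.Analysis.FluidPDE.curl v x‖ ^ 2) * Real.sqrt (∫ x, Literature.Analysis.FluidPDE.frobeniusNormSq (fderiv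 ℝ (Literature.Analysis.FluidPDE.curl v) x))

-- `GalileanGainLeTwo` holds: proved by `Summit.NavierStokesRegularity.NavierStokesRegularity.Theorems.galileanGainLeTwo_proof` (its module imports this route file, so no `_holds` link can be stated here).

/-- item stmt-NavierStokesRegularity-27677 · support · rank 9 · closed · proved by Summit.NavierStokesRegularity.NavierStokesRegularity.Theses.ExtremiserTransience.PlateauTransfer_holds (planner) · by planner
why it might fail: Lean size (zoom compactness + centre selection + persistence windows); mathematically the only soft spot is keeping sup‖W‖ = 1 attained near the plateau ball after renormalising by the local sup (else the plateau could sit in a region where the limit is locally trivial).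
sources: KochNadirashviliSereginSverak2009, SereginSverak2009, Summits/NavierStokesRegularity/NavierStokesRegularity/Theorems/ExtremiserTransiencePerFlowScaleLock.lean, Summits/NavierStokesRegularity/NavierStokesRegularity/Theorems/ExtremiserTransiencePerFlowEfficientTimesLogDensity.lean
[support · LINE g5-α part 2/3 · dynamic blow-up bookkeeping · size XL (Lean)] PLATEAU TRANSFER
(hypothesis = the sibling item `LocalNearPlateauStability` BY NAME): LocalNearPlateauStability ⇒ for
every Type-I singular classical Leray–Hopf flow (the flow prefix of 26567 verbatim: 0<C, 0<ν, 0<T,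
IsClassicalNSSolutionOn (Ico 0 T), IsLerayHopfOn, rapid decay of u 0, eventual rate √(T−t)‖u t x‖ ≤
C√ν, no smooth extension past T) WITHOUT a per-flow certificate (¬ the ∃θ<1-conclusion of 26567)
there is a TANGENT PLATEAU ELEMENT: W with IsKNSSBlowupLimit W, the Oseen–Duhamel identity W t =
heatFlow (W s) (t−s) − oseenDuhamel 1 s W W t (s<t<0), backward Type-I decay √(−t)‖W t x‖ ≤ K, and a
positive-measure set of times t ∈ (a,b), b ≤ 0, at which the slice attains its sup M on a set of
positive volume and has a non-zero curl. PLAN: no certificate ⇒ near-efficient times have positive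
upper log-density at T (landed p620874 `efficientTimes_logDensity_of_not_perFlow`, p623789
lockedTimes_logDensity) and are scale-locked (landed p625112
`PerFlow.scaleLock_at_nearEfficient_times`, `upperLock_at_nearEfficient_times`: λ(t)² = Z/P ≍
ν(T−t)); at each such time LNPS gives a ball B(x(t), rλ(t)) with nea -/
@[route_item "route-NavierStokesRegularity-ExtremiserTransience"]
def PlateauTransfer : Prop :=
  LocalNearPlateauStability → ∀ (C ν T : ℝ), 0 < C → 0 < ν → 0 < T → ∀ (u : ℝ → EuclideanSpace ℝ (Fin 3) → EuclideanSpace ℝ (Fin 3)) (p : ℝ → EuclideanSpace ℝ (Fin 3) → ℝ), Literature.Analysis.FluidPDE.IsClassicalNSSolutionOn (Set.Ico 0 T) ν 0 u p → Literature.Analysis.FluidPDE.IsLerayHopfOn T ν 0 (u 0) u → Literature.Analysis.FluidPDE.HasRapidSpatialDecay (u 0) → (∀ᶠ t in 𝓝[<] T, ∀ x, Real.sqrt (T - t) * ‖u t x‖ ≤ C * Real.sqrt ν) → ¬ Literature.Analysis.FluidPDE.HasSmoothExtensionPast ν 0 u T → ¬ (∃ θ : ℝ, 0 ≤ θ ∧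 θ < 1 ∧ ∀ κ : ℝ, (∀ (v : EuclideanSpace ℝ (Fin 3) → EuclideanSpace ℝ (Fin 3)) (M B : ℝ), ContDiff ℝ (⊤ : ℕ∞) v → Literature.Analysis.FluidPDE.VectorCalculus.IsDivFree v → (∀ x, ‖v x‖ ≤ M) → (∀ x, ‖fderiv ℝ v x‖ ≤ B) → (∫⁻ x, ‖iteratedFDeriv ℝ 0 v x‖ₑ ^ 2 < ⊤) → (∫⁻ x, ‖iteratedFDeriv ℝ 1 v x‖ₑ ^ 2 < ⊤) → (∫⁻ x, ‖iteratedFDeriv ℝ 2 v x‖ₑ ^ 2 < ⊤) → |∫ x, ⟪Literature.Analysis.FluidPDE.curl v x, fderiv ℝ v x (Literature.Analysis.FluidPDE.curl v x)⟫_ℝ| ≤ κ * M * Real.sqrt (∫ x, ‖Literature.Analysis.FluidPDE.curl v x‖ ^ 2) * Real.sqrt (∫ x, Literature.Analysis.FluidPDE.frobeniusNormSq (fderiv ℝ (Literature.Analysis.FluidPDE.curl v) x))) → ∃ t₁ ∈ Set.Ico 0 T, ∃ (k : ℝ → ℝ) (B : ℝ), Measurable k ∧ (∀ τ, 0 ≤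 k τ ∧ k τ ≤ 1) ∧ (∀ t ∈ Set.Ico t₁ T, ∀ M : ℝ, (∀ x, ‖u t x‖ ≤ M) → |∫ x, ⟪Literature.Analysis.FluidPDE.curl (u t) x, fderiv ℝ (u t) x (Literature.Analysis.FluidPDE.curl (u t) x)⟫_ℝ| ≤ k t * M * Real.sqrt (∫ x, ‖Literature.Analysis.FluidPDE.curl (u t) x‖ ^ 2) * Real.sqrt (∫ x, Literature.Analysis.FluidPDE.frobeniusNormSq (fderiv ℝ (Literature.Analysis.FluidPDE.curl (u t)) x))) ∧ (∀ t ∈ Set.Ico t₁ T, ∫ τ in t₁..t, k τ ^ 2 / (T - τ) ≤ (θ * κ) ^ 2 * Real.log ((T - t₁) / (T - t)) + B)) → ∃ (W : ℝ → EuclideanSpace ℝ (Fin 3) → EuclideanSpace ℝ (Fin 3)) (K a b : ℝ), (Literature.Analysis.FluidPDE.IsKNSSBlowupLimit W ∧ (∀ s t : ℝ, s < t → t < 0 → ∀ x, W t x = Literature.Analysis.FluidPDE.heatFlow (W s) (t - s) x - Literature.Analysis.FluidPDE.oseenDuhamel 1 s W W t x)) ∧ (∀ t : ℝ, t < 0 →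 ∀ x, Real.sqrt (-t) * ‖W t x‖ ≤ K) ∧ a < b ∧ b ≤ 0 ∧ 0 < MeasureTheory.volume {t : ℝ | t ∈ Set.Ioo a b ∧ ((∃ M : ℝ, (∀ x, ‖W t x‖ ≤ M) ∧ 0 < MeasureTheory.volume {x : EuclideanSpace ℝ (Fin 3) | ‖W t x‖ = M}) ∧ ∃ x, Literature.Analysis.FluidPDE.curl (W t) x ≠ 0)}

-- `PlateauTransfer` holds: proved by `Summit.NavierStokesRegularity.NavierStokesRegularity.Theses.ExtremiserTransience.PlateauTransfer_holds` (its module imports this route file, so no `_holds` link can be stated here).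

-- parent: PlateauTransfer · child (gen 1)
/--     item stmt-NavierStokesRegularity-27822 · support · rank 901 · closed · proved by Summit.NavierStokesRegularity.NavierStokesRegularity.Theorems.ExtremiserTransience.PlateauSliceTransfer_proof (prover)
    parent: PlateauTransfer · by planner
    why it might fail: The rescaled limit must keep the Oseen-mild identity from EVERY s<t<0 (uniform Duhamel tail control, KNSS2009 Lemma 6.1) and m>0 needs Leray's lower blow-up rate for this solution class; either may resist typing in the tree's mild framework.
    sources: arXiv:0709.3599, Leray1934, stmt-NavierStokesRegularity-27676, Summit.NavierStokesRegularity.NavierStokesRegularity.Theorems.ExtremiserTransiencePerFlowScaleLock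
[support · LINE g5-α repair of critic prices P1/P2 (idea-crit-3 11:46Z, adopted idea-crit-4 11:54Z)]
PLATEAU SLICE TRANSFER: `LocalNearPlateauStability` (27676) ⇒ for every Type-I non-extendable
classical flow with no depletion certificate there is a WEAK-CLASS ancient slice object: W
continuous on (−∞,0)×ℝ³, Oseen-mild from every s<t<0, Type-I decay √(−t)‖W t‖ ≤ K, and at ONE
interior time t₀<0 an exact speed plateau {‖W t₀ ·‖ = m} of positive volume with ‖W t₀‖ ≤ m
everywhere and m>0 (no `IsKNSSBlowupLimit`, no sup = 1, no time window). WHY THIS DISSOLVES P1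
(centre selection / tightness): `IsKNSSBlowupLimit`-type classes are intrinsic, so the zoom may
FOLLOW the plateau ball B(x(τₙ), rλ(τₙ)) given by LNPS at near-efficient scale-locked times τₙ → T
with εₙ, δₙ → 0 (¬certificate + landed log-density/scale-lock theorems p625112): centre (x(τₙ),
τₙ⁺), τₙ⁺ = τₙ + θ(T−τₙ); amplitude Aₙ = running max of ‖u‖ on [0, τₙ⁺] (so |Uₙ| ≤ 1 for rescaled
s<0; no `exists_lt_norm` is owed); the plateau time maps to sₙ = −θ(T−τₙ)Aₙ² ∈ [−θC², −θc²ν] (Type-I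
upper rate + Leray lower rate ‖u(t)‖∞ ≥ c√ν/√(T−t)) — pass to a subsequence sₙ → t₀ < 0; radius
r·λ(τₙ)·Aₙ ≍ r√ν (two-sided lock); level m = li -/
@[route_item "route-NavierStokesRegularity-ExtremiserTransience"]
def PlateauSliceTransfer : Prop :=
  LocalNearPlateauStability → ∀ (C ν T : ℝ), 0 < C → 0 < ν → 0 < T → ∀ (u : ℝ → EuclideanSpace ℝ (Fin 3) → EuclideanSpace ℝ (Fin 3)) (p : ℝ → EuclideanSpace ℝ (Fin 3) → ℝ), Literature.Analysis.FluidPDE.IsClassicalNSSolutionOn (Set.Ico 0 T) ν 0 u p → Literature.Analysis.FluidPDE.IsLerayHopfOn T ν 0 (u 0) u → Literature.Analysis.FluidPDE.HasRapidSpatialDecay (u 0) → (∀ᶠ t in 𝓝[<] T, ∀ x, Real.sqrt (T - t) * ‖u t x‖ ≤ C * Real.sqrt ν) → ¬ Literature.Analysis.FluidPDE.HasSmoothExtensionPast ν 0 u T → ¬ (∃ θ : ℝ, 0 ≤ θ ∧ θ < 1 ∧ ∀ κ : ℝ, (∀ (v : EuclideanSpace ℝ (Fin 3) → EuclideanSpace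 ℝ (Fin 3)) (M B : ℝ), ContDiff ℝ (⊤ : ℕ∞) v → Literature.Analysis.FluidPDE.VectorCalculus.IsDivFree v → (∀ x, ‖v x‖ ≤ M) → (∀ x, ‖fderiv ℝ v x‖ ≤ B) → (∫⁻ x, ‖iteratedFDeriv ℝ 0 v x‖ₑ ^ 2 < ⊤) → (∫⁻ x, ‖iteratedFDeriv ℝ 1 v x‖ₑ ^ 2 < ⊤) → (∫⁻ x, ‖iteratedFDeriv ℝ 2 v x‖ₑ ^ 2 < ⊤) → |∫ x, ⟪Literature.Analysis.FluidPDE.curl v x, fderiv ℝ v x (Literature.Analysis.FluidPDE.curl v x)⟫_ℝ| ≤ κ * M * Real.sqrt (∫ x, ‖Literature.Analysis.FluidPDE.curl v x‖ ^ 2) * Real.sqrt (∫ x, Literature.Analysis.FluidPDE.frobeniusNormSq (fderiv ℝ (Literature.Analysis.FluidPDE.curl v) x))) → ∃ t₁ ∈ Set.Ico 0 T, ∃ (k : ℝ → ℝ) (B : ℝ), Measurable k ∧ (∀ τ, 0 ≤ k τ ∧ k τ ≤ 1) ∧ (∀ t ∈ Set.Ico t₁ T, ∀ M : ℝ, (∀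 x, ‖u t x‖ ≤ M) → |∫ x, ⟪Literature.Analysis.FluidPDE.curl (u t) x, fderiv ℝ (u t) x (Literature.Analysis.FluidPDE.curl (u t) x)⟫_ℝ| ≤ k t * M * Real.sqrt (∫ x, ‖Literature.Analysis.FluidPDE.curl (u t) x‖ ^ 2) * Real.sqrt (∫ x, Literature.Analysis.FluidPDE.frobeniusNormSq (fderiv ℝ (Literature.Analysis.FluidPDE.curl (u t)) x))) ∧ (∀ t ∈ Set.Ico t₁ T, ∫ τ in t₁..t, k τ ^ 2 / (T - τ) ≤ (θ * κ) ^ 2 * Real.log ((T - t₁) / (T - t)) + B)) → ∃ (W : ℝ → EuclideanSpace ℝ (Fin 3) → EuclideanSpace ℝ (Fin 3)) (K t₀ m : ℝ), ContinuousOn (Function.uncurry W) (Set.Iio (0 : ℝ) ×ˢ Set.univ) ∧ (∀ s t : ℝ, s < t → t < 0 → ∀ x, W t x = Literature.Analysis.FluidPDE.heatFlow (W s) (t - s) x - Literature.Analysis.FluidPDE.oseenDuhamel 1 s W W t x) ∧ (∀ t : ℝ, t < 0 → ∀ x, Real.sqrt (-t) * ‖W t x‖ ≤ K) ∧ t₀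 < 0 ∧ 0 < m ∧ (∀ y, ‖W t₀ y‖ ≤ m) ∧ 0 < MeasureTheory.volume {y : EuclideanSpace ℝ (Fin 3) | ‖W t₀ y‖ = m}

-- `PlateauSliceTransfer` holds: proved by `Summit.NavierStokesRegularity.NavierStokesRegularity.Theorems.ExtremiserTransience.PlateauSliceTransfer_proof` (its module imports this route file, so no `_holds` link can be stated here).

-- parent: PlateauTransfer · child (gen 1)
/--     item stmt-NavierStokesRegularity-27823 · support · rank 902 · closed · proved by Summit.NavierStokesRegularity.NavierStokesRegularity.Theses.ExtremiserTransience.plateauSliceRigidity (prover)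
    parent: PlateauTransfer · by planner
    why it might fail: Low risk: needs the local energy equality WITH the Riesz pressure for bounded Oseen-mild ancient fields and the gradient decay |grad W(s)| <= C(K)/(-s) (KNSS2009 sec. 4), both classical but untyped; a parasitic pressure would break it, Oseen-mildness excludes it.
    sources: arXiv:0709.3599, book:seregin2014, Summit.NavierStokesRegularity.NavierStokesRegularity.Theorems.PoloidalWindowDoorPoloidalWindowRigidityTypeIAnalytic.typeI_mild_slice_analytic, Literature.Analysis.Calculus.realAnalytic_zeroSet_null_holds
[support · LINE g5-α repair; also the typed home of LINE β's energy-per-ball lemma (critic Q3)]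
PLATEAU SLICE RIGIDITY: no continuous, Oseen-mild (every s<t<0), Type-I-decaying (√(−t)‖W t x‖ ≤ K)
ancient field has at an interior time t₀<0 an exact speed plateau {y : ‖W t₀ y‖ = m} of positive
volume with ‖W t₀‖ ≤ m and m > 0. PROOF ROUTE (all inputs classical or in tree): (1) slice
analyticity — `PoloidalWindowDoorPoloidalWindowRigidityTypeIAnalytic.typeI_mild_slice_analytic`
(hypotheses = HasTypeITimeDecay K W [= the decay clause after dividing by √(−t)], continuity, the
Oseen-mild clause with `heatExtension`; bridge `heatFlow_of_pos`); (2) y ↦ ‖W t₀ y‖² − m² is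
real-analytic with a positive-volume zero set ⇒ ≡ 0 (`realAnalytic_zeroSet_null_holds`) ⇒ constant
speed m on ℝ³ ⇒ ∫_{B_ρ}‖W t₀‖² = (4π/3)m²ρ³ for every ρ; (3) LOCAL ENERGY BUDGET (the one new lemma,
M-sized, classical): for such fields ∫_{B_ρ}‖W(t)‖² ≤ C(K)·ρ²/√(−t) for all ρ>0, t<0 — from the
local energy equality on B_{2ρ} with cut-off φ_ρ integrated over (−∞, t): initial term ≤ K²ρ³/(−σ₀)
→ 0; cubic flux ∫|W|³|∇φ| ≤ C K³ρ²(−σ)^{−3/2}; pressure flux with the Riesz pressure p =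
R_iR_j(W_iW_j) (pinned by Oseen-mildness), ‖ -/
@[route_item "route-NavierStokesRegularity-ExtremiserTransience"]
def PlateauSliceRigidity : Prop :=
  ¬ ∃ (W : ℝ → EuclideanSpace ℝ (Fin 3) → EuclideanSpace ℝ (Fin 3)) (K t₀ m : ℝ), ContinuousOn (Function.uncurry W) (Set.Iio (0 : ℝ) ×ˢ Set.univ) ∧ (∀ s t : ℝ, s < t → t < 0 → ∀ x, W t x = Literature.Analysis.FluidPDE.heatFlow (W s) (t - s) x - Literature.Analysis.FluidPDE.oseenDuhamel 1 s W W t x) ∧ (∀ t : ℝ, t < 0 → ∀ x, Real.sqrt (-t) * ‖W t x‖ ≤ K) ∧ t₀ < 0 ∧ 0 < m ∧ (∀ y, ‖W t₀ y‖ ≤ m) ∧ 0 < MeasureTheory.volume {y : EuclideanSpace ℝ (Fin 3) | ‖W t₀ y‖ = m}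

-- `PlateauSliceRigidity` holds: proved by `Summit.NavierStokesRegularity.NavierStokesRegularity.Theses.ExtremiserTransience.plateauSliceRigidity` (its module imports this route file, so no `_holds` link can be stated here).

-- parent: PlateauTransfer · glue (gen 1)
/--     item stmt-NavierStokesRegularity-27824 · support · rank 903 · closed · proved by Summit.NavierStokesRegularity.NavierStokesRegularity.Theses.ExtremiserTransience.plateauTransferOfSlice (planner)
    parent: PlateauTransfer · GLUE: children ⟹ parent · by planner
GLUE (ex falso): the weak-class slice object produced by PlateauSliceTransfer is excluded by
PlateauSliceRigidity, so PlateauTransfer's conclusion holds vacuously; term: fun h1 h2 hL C nu T hC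
hnu hT u p hcl hLH hdec hrate hne hc => (h2 (h1 hL C nu T hC hnu hT u p hcl hLH hdec hrate hne
hc)).elim (evidence lineP/Sketch.lean plateauTransfer_of_slice, rc 0). LINE g5-alpha repair
answering critic prices P1 (centre selection dissolved by the moving-centre zoom into an intrinsic
weak class) and P2 (limit bookkeeping recorded); no summit is proved by a line. -/
@[route_item "route-NavierStokesRegularity-ExtremiserTransience"]
def PlateauTransferOfSlice : Prop :=
  PlateauSliceTransfer → PlateauSliceRigidity → PlateauTransfer

-- `PlateauTransferOfSlice` holds: proved by `Summit.NavierStokesRegularity.NavierStokesRegularity.Theses.ExtremiserTransience.plateauTransferOfSlice` (its module imports this route file, so no `_holds` link can be stated here).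

/-- item stmt-NavierStokesRegularity-27678 · support · rank 9 · closed · proved by Summit.NavierStokesRegularity.NavierStokesRegularity.Theses.ExtremiserTransience.plateauAncientRigidity (planner) · by planner
why it might fail: Only Lean cost: needs the local energy identity with pressure (BMO bound) for Oseen-mild bounded ancient solutions and analytic continuation in 7 variables; mathematically each step is classical.
sources: KochNadirashviliSereginSverak2009, DongZhang2020, Summits/NavierStokesRegularity/NavierStokesRegularity/Theorems/PoloidalWindowDoorPoloidalWindowRigidityTypeIAnalytic.lean
[support · LINE g5-α part 3/3 · rigidity · size L (math) / XL (Lean)] NO TANGENT PLATEAU ELEMENT: ¬∃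
(W, K, a, b) as in the conclusion of PlateauTransfer. PLAN (inputs in the tree or classical): (1) an
Oseen-mild bounded ancient field with Type-I backward decay is jointly real-analytic in (t,x) on
(−∞,0)×ℝ³ (tree:
`Theorems.PoloidalWindowDoorPoloidalWindowRigidityTypeIAnalytic.typeI_mild_analyticOnNhd` /
`typeI_mild_slice_analytic`, underneath
`LocalSineTubeDoorProfileAlignedWindowRigidityAncient.analyticOnNhd_uncurry`; hypotheses
HasTypeITimeDecay C W (= the decay clause), continuity (IsKNSSBlowupLimit.smooth), Oseen-mild with
heatExtension = heatFlow for τ>0 by `Literature.Analysis.FluidPDE.heatFlow_of_pos`); (2) at a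
plateau time, x ↦ M² − ‖W t x‖² is real-analytic, ≥ 0, with a positive-volume zero set ⇒ ≡ 0 (tree
`Literature…RealAnalyticZeroSetProofs.realAnalytic_zeroSet_null_holds`, `volume_zeroSet_null_pi`):
constant speed at that time; (3) (t,x,y) ↦ ‖W t x‖² − ‖W t y‖² is analytic on the connected set
(−∞,0)×ℝ⁶ and vanishes on (positive-measure set of times)×ℝ⁶ ⇒ constant speed M(t) at ALL t<0; (4)
for constant speed W·ΔW = Δ(½‖W‖²) − |∇W|² = −|∇W|², so the pointwise energy -/
@[route_item "route-NavierStokesRegularity-ExtremiserTransience"]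
def PlateauAncientRigidity : Prop :=
  ¬ ∃ (W : ℝ → EuclideanSpace ℝ (Fin 3) → EuclideanSpace ℝ (Fin 3)) (K a b : ℝ), (Literature.Analysis.FluidPDE.IsKNSSBlowupLimit W ∧ (∀ s t : ℝ, s < t → t < 0 → ∀ x, W t x = Literature.Analysis.FluidPDE.heatFlow (W s) (t - s) x - Literature.Analysis.FluidPDE.oseenDuhamel 1 s W W t x)) ∧ (∀ t : ℝ, t < 0 → ∀ x, Real.sqrt (-t) * ‖W t x‖ ≤ K) ∧ a < b ∧ b ≤ 0 ∧ 0 < MeasureTheory.volume {t : ℝ | t ∈ Set.Ioo a b ∧ ((∃ M : ℝ, (∀ x, ‖W t x‖ ≤ M) ∧ 0 < MeasureTheory.volume {x : EuclideanSpace ℝ (Fin 3) | ‖W t x‖ = M}) ∧ ∃ x, Literature.Analysis.FluidPDE.curl (W t) x ≠ 0)}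

-- `PlateauAncientRigidity` holds: proved by `Summit.NavierStokesRegularity.NavierStokesRegularity.Theses.ExtremiserTransience.plateauAncientRigidity` (its module imports this route file, so no `_holds` link can be stated here).

/-- item stmt-NavierStokesRegularity-21886 · assembly · rank 1 · closed · proved by Summit.NavierStokesRegularity.NavierStokesRegularity.Theorems.extremiserTransience_assembly_proof (prover) · by planner
sources: Leray1934, KNSS2009
[assembly] NearExtremalTransience → DepletionCascade → NoTypeII → AveragedRung →
NavierStokesRegularity (the curried form of `closes`; proved inside glue.lean as `have hAsm :
Assembly`). -/
@[route_item "route-NavierStokesRegularity-ExtremiserTransience"]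
def Assembly : Prop :=
  NearExtremalTransience → DepletionCascade → NoTypeII → AveragedRung → NavierStokesRegularity

-- `Assembly` holds: proved by `Summit.NavierStokesRegularity.NavierStokesRegularity.Theorems.extremiserTransience_assembly_proof` (its module imports this route file, so no `_holds` link can be stated here).

/-! D-0027 §2.1 — DECIDING THEOREM (planner-authored via `route open/edit --closes-file`; by planner-ns-idea-5-g4-0 2026-08-28T07:22:38Z):
its hypotheses are this route's items and its conclusion the sub-problem Statement (glue_lint), and it elaborates with this file. -/

@[closes "route-NavierStokesRegularity-ExtremiserTransience"] theorem closes (hT : NearExtremalTransiencePerFlow) (hC : DepletionCascade) (hII : NoTypeII) (hA : AveragedRung) :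
    NavierStokesRegularity := by
  apply Summit.NavierStokesRegularity.NavierStokesRegularity.Theorems.navierStokesRegularity_of_noBlowup
  intro ν T hν hT0 u p hcl hLH hdec
  by_contra hext
  obtain ⟨C', hC'⟩ := hII ν T hν hT0 u p ⟨hcl, hext⟩ hLH hdec
  have hν' : 0 < Real.sqrt ν := Real.sqrt_pos.2 hν
  have hCpos : 0 < max (C' / Real.sqrt ν) 1 := lt_of_lt_of_le one_pos (le_max_right _ _)
  have hrate : ∀ᶠ t in nhdsWithin T (Set.Iio T), ∀ x,
      Real.sqrt (T - t) * ‖u t x‖ ≤ max (C' / Real.sqrt ν) 1 * Real.sqrt ν := by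
    have hlt : ∀ᶠ t in nhdsWithin T (Set.Iio T), t < T := self_mem_nhdsWithin
    filter_upwards [hC', hlt] with t ht htT
    intro x
    have hTt : 0 < Real.sqrt (T - t) := Real.sqrt_pos.2 (sub_pos.2 htT)
    calc Real.sqrt (T - t) * ‖u t x‖
        ≤ Real.sqrt (T - t) * (C' / Real.sqrt (T - t)) := mul_le_mul_of_nonneg_left (ht x) hTt.le
      _ = C' := by field_simp
      _ = (C' / Real.sqrt ν) * Real.sqrt ν := by field_simp
      _ ≤ max (C' / Real.sqrt ν) 1 * Real.sqrt ν := mul_le_mul_of_nonneg_right (le_max_left _ _) hν'.le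
  have hr : (0 : ℝ) < 1 / (2 * max (C' / Real.sqrt ν) 1) := by positivity
  have hrC : 1 / (2 * max (C' / Real.sqrt ν) 1) * max (C' / Real.sqrt ν) 1 < 1 := by
    rw [div_mul_eq_mul_div, one_mul, div_lt_one (by positivity)]
    linarith
  -- the PER-FLOW exponent θ_u < 1 of this flow is exactly the hypothesis the cascade consumes
  have hdr := hC _ ν T hCpos hν hT0 u p hcl hLH hdec hrate hext
    (hT _ ν T hCpos hν hT0 u p hcl hLH hdec hrate hext) _ hr
  exact hext (hA _ _ ν T hr.le hCpos hrC hν hT0 u p hcl hLH hdec hrate hdr)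

end Summit.NavierStokesRegularity.NavierStokesRegularity.Theses.ExtremiserTransience
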